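import Mathlib.Algebra.MvPolynomial.Funext
import Mathlib.Algebra.MvPolynomial.Supported
import Literature.Computability.AlgebraicComplexity.OrbitCoordinateRingProofs
import Literature.NumberTheory.DiophantineGeometry.GLHighestWeightFacts
import HarnessLib

/-!
# Highest weights of coordinate rings of orbit closures: partition form, dominance, and
# BIP's Theorem 4.9 (Kadish–Landsberg) — proved on the orbit

Let `k` be an infinite field, `σ` a finite linearly ordered set of variables, `f ∈ k[x_σ]`, and
`k[Δ_m[f]] = k[Sym^m] ⧸ I(GL · f)` the coordinate ring of the orbit closure of `f` in degree `m`
(G20's `OrbitCoordRing f m` with its `GL σ k`-action `orbitCoordRep f m`; highest weights for the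
upper triangular Borel as in `GLHighestWeight.lean`). This file proves, WITHOUT complete
reducibility or Schur–Weyl theory, the standard shape constraints on the highest weights `χ`
occurring in `k[Δ_m[f]]`:

* `isDominant_of_hasHighestWeight_orbitCoordRep`: `χ` is dominant;
* `exists_eq_dualOfPartition_of_hasHighestWeight_orbitCoordRep`: `χ = λ^*` is the dual weight of
  a partition `λ ⊢ D·m` (`D` the degree) with at most `|σ|` parts (BLMW 2011 (5.2.2));
* `exists_size_eq_and_mul_le_of_hasHighestWeight_orbitCoordRep_X_pow_mul` = BIP Thm. 4.9(2)
  (Kadish–Landsberg): for a padded form `f = X_a^r p`, `λ₁ ≥ r D`;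
* `apply_eq_zero_of_hasHighestWeight_orbitCoordRep_of_vars_subset` = BIP Thm. 4.9(1): for `f` in
  the variables `A ⊆ σ` only, `ℓ(λ) ≤ |A|`.

BIP (arXiv:1604.06431v3) Thm. 4.9: "(1) Assume `π : V → W` is a projection, `p ∈ Sym^n W^*`, and
let `Z` denote the `GL(V)`-orbit closure of `π^*(p) ∈ Sym^n V^*`. If `λ ⊢ nd` occurs in `ℂ[Z]_d`,
then `ℓ(λ) ≤ dim W`. (2) Let `q = X^{n-m} p` where `X ∈ V^*` and `p ∈ Sym^m V^*` for `m ≤ n`. Let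
`Z` denote the `GL(V)`-orbit closure of `q`. If `λ ⊢ nd` occurs in `ℂ[Z]_d`, then `|λ̄| ≤ md`"
(equivalently `λ₁ ≥ (n-m)d`); BIP Thm. 2.1 ([27] = Kadish–Landsberg 2014) is the special case of
the padded permanent. BIP prove Thm. 4.9 with their tableau calculus (Thm. 4.7); the proofs here
are different and elementary.

## Method (all statements over an infinite field)

A nonzero `B`-semi-invariant `x ∈ k[Δ_m[f]]` of weight `χ` lifts to `F ∈ k[Sym^m]`,
`F ∉ I(GL · f)`, with `b · F - χ(b) F ∈ I(GL · f)` for upper triangular `b`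
(`exists_lift_of_mem_highestWeightSpace_orbitCoordRep`); since the ideal vanishes on the orbit,
`F(b⁻¹ · q) = χ(b) F(q)` at every orbit point `q` (`aeval_formCoeff_inv_eq_of_sub_mem`), and
`F(g · f) ≠ 0` for `g` in a nonempty Zariski open subset of `GL`
(`exists_gl_aeval_ne_zero_and_eval_ne_zero`, via Mathlib's `MvPolynomial.eq_of_eval_eq_on_gl`).
§1 computes the torus action on monomials of `k[Sym^m]` (`coordSubst_monomial_of_isDiagonalGL`:
the monomial `∏ X_d^{s(d)}` has weight `monWeight s = -∑ s(d) d`) and proves linear independence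
of torus characters (`eq_zero_of_sum_mul_weightChar_eq_zero`), whence the **master lemma**
`exists_monWeight_eq_of_sub_mem`: at an orbit point `q` with `F(q) ≠ 0` some monomial of `F` has
torus weight exactly `χ` and all its coordinates nonzero at `q`. Consequences: `χ ≤ 0` and
`|χ| = -m D` (§4); choosing `q = X_{iₘ}^r p₁` (§5, a column-`iₘ` Borel element) gives Thm. 4.9(2);
choosing `q ∈ k[X_T]`, `T` the top `|A|` indices (§6, big Schubert cell: a unipotent `b = 1 + C`,
`C² = 0`, built from the inverse of the `T × A` minor of a generic `g`) gives Thm. 4.9(1).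
Dominance (§3) probes the `GL₂ ⊂ GL_σ` at a pair `i < j` (`blockTwo`): with
`A(s) = (0,-1;1,s) = b(s) u(1/s)`, `b(s) = (1/s,-1;0,s)` upper triangular, the identity
`F(A(s) · q) s^{χ_j-χ_i} = F(u(1/s) · q)` between a polynomial in `s` and a polynomial in `1/s` with
nonzero constant term forces `χ_i ≥ χ_j` (`Polynomial.eval_zero_eq_zero_of_mul_pow_eq_eval_inv`).

## References

* P. Bürgisser, C. Ikenmeyer, G. Panova, *No occurrence obstructions in geometric complexity
  theory*, J. AMS 32 (2019) = arXiv:1604.06431v3, Thm. 2.1, Thm. 4.9 (key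
  `BurgisserIkenmeyerPanovaJAMS2019`).
* P. Bürgisser, J.M. Landsberg, L. Manivel, J. Weyman, *An overview of mathematical issues arising
  in the geometric complexity theory approach to VP ≠ VNP*, SIAM J. Comput. 40 (2011), §4.4,
  (5.2.2) (key `BurgisserEtAl2011`).
* K. Mulmuley, M. Sohoni, *Geometric complexity theory I*, SIAM J. Comput. 31 (2001), §4–§5 (key
  `MulmuleySohoniSIAM2001`).
* W. Fulton, J. Harris, *Representation Theory*, GTM 129, §15.1, §15.3, §15.5, Ex. 15.50 (key
  `FultonHarrisGTM129`); R. Goodman, N. Wallach, *Symmetry, Representations, and Invariants*,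
  GTM 255, §2.4.1, §3.1.3, Thm. 3.2.5 (key `GoodmanWallachGTM255`).
-/

open MvPolynomial

namespace Literature.Computability.AlgebraicComplexity

variable {σ k : Type*} [Fintype σ] [LinearOrder σ] [Field k]

/-! ### Diagonal matrices act on monomials by characters -/

omit [LinearOrder σ] in
/-- A diagonal substitution `X i ↦ β i X i` multiplies the monomial `c X^e` by `∏ β_i^{e_i}`.
Fulton–Harris §15.5 (weights of `Sym^m V`). [folklore] -/
theorem linSubst_diagonal_monomial [DecidableEq σ] (β : σ → k) (e : σ →₀ ℕ) (c : k) :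
    linSubst σ k (Matrix.diagonal β) (monomial e c) =
      (e.prod fun i n => β i ^ n) • monomial e c := by
  have hX : ∀ i, linSubst σ k (Matrix.diagonal β) (X i) = C (β i) * X i := by
    intro i
    rw [linSubst_X, Finset.sum_eq_single i (fun j _ hj => by
      rw [Matrix.diagonal_apply_ne _ hj, zero_smul]) (fun h => absurd (Finset.mem_univ i) h),
      Matrix.diagonal_apply_eq, smul_eq_C_mul]
  rw [monomial_eq, map_mul, linSubst_C, Finsupp.prod, map_prod]
  simp only [map_pow, hX, mul_pow, Finset.prod_mul_distrib]
  rw [smul_eq_C_mul, Finsupp.prod, map_prod]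
  simp only [map_pow]
  ring

/-- The matrix of a diagonal element of `GL` is `diagonal` of its diagonal entries.
Fulton–Harris §15.3. [folklore] -/
theorem coe_eq_diagonal_of_isDiagonalGL {t : GL σ k} (ht : Literature.NumberTheory.DiophantineGeometry.IsDiagonalGL t) :
    (t : Matrix σ σ k) = Matrix.diagonal fun i => (t : Matrix σ σ k) i i :=
  ((Literature.NumberTheory.DiophantineGeometry.isDiagonalGL_iff_isDiag t).mp ht).diagonal_diag.symm

/-- The diagonal entries of the inverse of an upper triangular invertible matrix are the
inverses of its diagonal entries (same statement and proof as
`inv_apply_diag_of_isUpperTriangular` of the downstream file `OccurrenceObstructionsBIP.lean`,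
primed to avoid the clash; librarian may merge). Goodman–Wallach §3.1.3. [folklore] -/
theorem inv_apply_diag_of_isUpperTriangular' {g : GL σ k} (hg : Literature.NumberTheory.DiophantineGeometry.IsUpperTriangular g) (i : σ) :
    ((g⁻¹ : GL σ k) : Matrix σ σ k) i i = ((g : Matrix σ σ k) i i)⁻¹ := by
  have hg' : Literature.NumberTheory.DiophantineGeometry.IsUpperTriangular g⁻¹ := (Literature.NumberTheory.DiophantineGeometry.borelSubgroup σ k).inv_mem hg
  have h := Literature.NumberTheory.DiophantineGeometry.diag_mul_of_isUpperTriangular hg hg' i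
  rw [mul_inv_cancel, Units.val_one, Matrix.one_apply_eq] at h
  exact (eq_inv_of_mul_eq_one_right h.symm)

variable {m : ℕ}

omit [LinearOrder σ] [Field k] in
/-- The torus weight of a monomial `∏_d X_d^{s(d)}` of the coordinate ring `k[Sym^m (k^σ)]`
(`X_d` the coefficient of the degree-`m` monomial `x^d`): `-(∑_d s(d) · d)`, i.e. minus the
total number of occurrences of each variable `x_i` (the torus `diag(α)` acts on `X_d` by
`α^{-d}`, `coordSubst_monomial_of_isDiagonalGL`). Fulton–Harris §15.5; BLMW 2011 (5.2.2)
(weights of coordinate rings are duals). [folklore] -/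
def monWeight [DecidableEq σ] (s : DegIdx σ m →₀ ℕ) : Literature.NumberTheory.DiophantineGeometry.Weight σ :=
  fun i => -((∑ d ∈ s.support, s d * d.1 i : ℕ) : ℤ)

omit [LinearOrder σ] [Field k] in
/-- Unfolding lemma for `monWeight`. [folklore] -/
theorem monWeight_apply [DecidableEq σ] (s : DegIdx σ m →₀ ℕ) (i : σ) :
    monWeight s i = -((∑ d ∈ s.support, s d * d.1 i : ℕ) : ℤ) :=
  rfl

/-- **Monomials of `k[Sym^m]` are torus weight vectors**: a diagonal `t ∈ GL` acts on the
monomial `c ∏_d X_d^{s(d)}` of the coordinate ring by the character `weightChar (monWeight s) t`.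
Fulton–Harris §15.5. [folklore] -/
theorem coordSubst_monomial_of_isDiagonalGL {t : GL σ k} (ht : Literature.NumberTheory.DiophantineGeometry.IsDiagonalGL t)
    (s : DegIdx σ m →₀ ℕ) (c : k) :
    coordSubst m t (monomial s c) = Literature.NumberTheory.DiophantineGeometry.weightChar (monWeight s) t • monomial s c := by
  classical
  -- the inverse is diagonal with inverse diagonal entries
  have ht' : Literature.NumberTheory.DiophantineGeometry.IsDiagonalGL t⁻¹ := (Literature.NumberTheory.DiophantineGeometry.torusSubgroup σ k).inv_mem ht
  set α : σ → k := fun i => (t : Matrix σ σ k) i i with hα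
  have hinv : ((t⁻¹ : GL σ k) : Matrix σ σ k) = Matrix.diagonal fun i => (α i)⁻¹ := by
    rw [coe_eq_diagonal_of_isDiagonalGL ht']
    congr 1
    funext i
    exact inv_apply_diag_of_isUpperTriangular' ht.isUpperTriangular i
  -- the scalar by which `t` acts on the coordinate `X_d`
  set γ : DegIdx σ m → k := fun d => ∏ i, (α i)⁻¹ ^ (d.1 i) with hγ
  have hφ : (fun d : DegIdx σ m => ∑ e : DegIdx σ m,
      coeff d.1 (linSubstRep σ k t⁻¹ (monomial e.1 1)) • (X e : MvPolynomial (DegIdx σ m) k)) =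
      fun d => C (γ d) * X d := by
    funext d
    have hcoeff : ∀ e : DegIdx σ m,
        coeff d.1 (linSubstRep σ k t⁻¹ (monomial e.1 1)) = if e = d then γ d else 0 := by
      intro e
      rw [linSubstRep_apply, hinv, linSubst_diagonal_monomial, coeff_smul, coeff_monomial,
        smul_eq_mul]
      by_cases hed : e = d
      · subst hed
        rw [if_pos rfl, if_pos rfl, mul_one, hγ, Finsupp.prod_fintype]
        intro i
        exact pow_zero _
      · have : e.1 ≠ d.1 := fun h => hed (Subtype.ext h)
        rw [if_neg this, if_neg hed, mul_zero]
    simp only [hcoeff, ite_smul, zero_smul, Finset.sum_ite_eq', Finset.mem_univ, if_true,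
      smul_eq_C_mul]
  -- act on the monomial
  have h1 : coordSubst m t (monomial s c) =
      C (c * ∏ d ∈ s.support, γ d ^ s d) * ∏ d ∈ s.support, X d ^ s d := by
    change aeval _ (monomial s c) = _
    rw [hφ, aeval_monomial, Finsupp.prod]
    simp only [mul_pow, Finset.prod_mul_distrib, ← map_pow, ← map_prod, algebraMap_eq]
    rw [map_mul]
    ring
  have h2 : (monomial s c : MvPolynomial (DegIdx σ m) k) = C c * ∏ d ∈ s.support, X d ^ s d := by
    rw [monomial_eq, Finsupp.prod]
  rw [h1, h2, smul_eq_C_mul, map_mul]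
  -- the scalar is the weight character
  suffices hw : ∏ d ∈ s.support, γ d ^ s d = Literature.NumberTheory.DiophantineGeometry.weightChar (monWeight s) t by
    rw [hw]; ring
  -- both sides as double products
  have lhs : ∏ d ∈ s.support, γ d ^ s d = ∏ i, ∏ d ∈ s.support, (α i)⁻¹ ^ (s d * d.1 i) := by
    rw [Finset.prod_comm]
    refine Finset.prod_congr rfl fun d _ => ?_
    rw [hγ]
    simp only
    rw [← Finset.prod_pow]
    refine Finset.prod_congr rfl fun i _ => ?_
    rw [← pow_mul, mul_comm]
  rw [lhs, Literature.NumberTheory.DiophantineGeometry.weightChar]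
  refine Finset.prod_congr rfl fun i _ => ?_
  rw [monWeight_apply, zpow_neg, zpow_natCast, ← inv_pow, ← Finset.prod_pow_eq_pow_sum]


/-! ### Linear independence of torus characters over an infinite field -/

/-- The diagonal element of `GL` with prescribed nonzero diagonal entries `x`. Fulton–Harris
§15.3. [folklore] -/
def torusElt (x : σ → k) (hx : ∀ i, x i ≠ 0) : GL σ k :=
  Matrix.GeneralLinearGroup.mkOfDetNeZero (Matrix.diagonal x)
    (by rw [Matrix.det_diagonal]; exact Finset.prod_ne_zero_iff.mpr fun i _ => hx i)

/-- The matrix of `torusElt x hx` is `diagonal x`. [folklore] -/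
@[simp]
theorem coe_torusElt (x : σ → k) (hx : ∀ i, x i ≠ 0) :
    ((torusElt x hx : GL σ k) : Matrix σ σ k) = Matrix.diagonal x :=
  Matrix.GeneralLinearGroup.val_mkOfDetNeZero _ _

/-- `torusElt x hx` is diagonal. [folklore] -/
theorem isDiagonalGL_torusElt (x : σ → k) (hx : ∀ i, x i ≠ 0) :
    Literature.NumberTheory.DiophantineGeometry.IsDiagonalGL (torusElt x hx) := by
  rw [Literature.NumberTheory.DiophantineGeometry.isDiagonalGL_iff_isDiag, coe_torusElt]
  exact Matrix.isDiag_diagonal x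

/-- The weight character at `torusElt x hx` is the Laurent monomial `∏ x_i^{χ_i}`. [folklore] -/
theorem weightChar_torusElt (χ : Literature.NumberTheory.DiophantineGeometry.Weight σ) (x : σ → k) (hx : ∀ i, x i ≠ 0) :
    Literature.NumberTheory.DiophantineGeometry.weightChar χ (torusElt x hx) = ∏ i, x i ^ χ i := by
  simp [Literature.NumberTheory.DiophantineGeometry.weightChar, coe_torusElt, Matrix.diagonal_apply_eq]

/-- **Linear independence of the characters of the torus** (Dedekind–Artin, in the Laurent
monomial form): over an infinite field, if a finite linear combination
`∑_{v ∈ V} A_v · t^v` of distinct characters `t ↦ weightChar v t` vanishes at every diagonal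
`t ∈ GL`, then all `A_v = 0`. (Shift exponents to be nonnegative, multiply by `∏ X_i` to get a
polynomial vanishing on all of `k^σ`, `MvPolynomial.funext`.) Lang, *Algebra*, VI §4 (Artin's
theorem on independence of characters); Goodman–Wallach §3.1.3. [folklore] -/
theorem eq_zero_of_sum_mul_weightChar_eq_zero [Infinite k] (V : Finset (Literature.NumberTheory.DiophantineGeometry.Weight σ))
    (A : Literature.NumberTheory.DiophantineGeometry.Weight σ → k)
    (h : ∀ t : GL σ k, Literature.NumberTheory.DiophantineGeometry.IsDiagonalGL t → ∑ v ∈ V, A v * Literature.NumberTheory.DiophantineGeometry.weightChar v t = 0) :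
    ∀ v ∈ V, A v = 0 := by
  classical
  -- shift all exponents by `N₀` to make them nonnegative
  set N₀ : ℕ := ∑ v ∈ V, ∑ i, (v i).natAbs with hN₀
  have hnn : ∀ v ∈ V, ∀ i, 0 ≤ v i + N₀ := by
    intro v hv i
    have h1 : (v i).natAbs ≤ ∑ j, (v j).natAbs :=
      Finset.single_le_sum (f := fun j => (v j).natAbs) (fun _ _ => Nat.zero_le _)
        (Finset.mem_univ i)
    have h2 : ∑ j, (v j).natAbs ≤ N₀ :=
      Finset.single_le_sum (f := fun w => ∑ j, (w j).natAbs) (fun _ _ => Nat.zero_le _) hv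
    omega
  set expo : Literature.NumberTheory.DiophantineGeometry.Weight σ → (σ →₀ ℕ) := fun v =>
    Finsupp.equivFunOnFinite.symm fun i => (v i + N₀).toNat with hexpo
  have hexpo_apply : ∀ v i, expo v i = (v i + N₀).toNat := fun v i => by simp [hexpo]
  have hinj : ∀ v ∈ V, ∀ v' ∈ V, expo v = expo v' → v = v' := by
    intro v hv v' hv' hvv
    funext i
    have h1 := congrArg (fun e => (e i : ℤ)) hvv
    simp only [hexpo_apply, Int.toNat_of_nonneg (hnn v hv i),
      Int.toNat_of_nonneg (hnn v' hv' i)] at h1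
    omega
  -- the polynomial `P = ∑ A_v X^{v + N₀}` vanishes at every point with nonzero coordinates
  set P : MvPolynomial σ k := ∑ v ∈ V, monomial (expo v) (A v) with hP
  have hPeval : ∀ x : σ → k, (∀ i, x i ≠ 0) → eval x P = 0 := by
    intro x hx
    have key := h (torusElt x hx) (isDiagonalGL_torusElt x hx)
    simp only [weightChar_torusElt] at key
    have hterm : ∀ v ∈ V, eval x (monomial (expo v) (A v)) =
        (A v * ∏ i, x i ^ v i) * ∏ i, x i ^ N₀ := by
      intro v hv
      rw [eval_monomial, Finsupp.prod_fintype _ _ (fun i => pow_zero (x i)), mul_assoc,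
        ← Finset.prod_mul_distrib]
      congr 1
      refine Finset.prod_congr rfl fun i _ => ?_
      rw [hexpo_apply, ← zpow_natCast, Int.toNat_of_nonneg (hnn v hv i), zpow_add₀ (hx i),
        zpow_natCast]
    rw [hP, map_sum, Finset.sum_congr rfl hterm, ← Finset.sum_mul, key, zero_mul]
  have hPX : P * ∏ i, X i = 0 := by
    apply MvPolynomial.funext
    intro x
    rw [map_mul, map_prod, map_zero]
    simp only [eval_X]
    by_cases hx : ∀ i, x i ≠ 0
    · rw [hPeval x hx, zero_mul]
    · obtain ⟨i, hi⟩ := not_forall.mp hx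
      rw [Finset.prod_eq_zero (Finset.mem_univ i) (not_not.mp hi), mul_zero]
  have hP0 : P = 0 := by
    rcases mul_eq_zero.mp hPX with h0 | h0
    · exact h0
    · exact absurd h0 (Finset.prod_ne_zero_iff.mpr fun i _ => X_ne_zero i)
  -- read off the coefficients
  intro v hv
  have hc := congrArg (coeff (expo v)) hP0
  rw [coeff_zero, hP, coeff_sum, Finset.sum_eq_single v] at hc
  · simpa using hc
  · intro v' hv' hne
    rw [coeff_monomial, if_neg]
    exact fun h => hne (hinj v' hv' v hv h)
  · exact fun h => absurd hv h

/-! ### Torus weight components of a polynomial at a point -/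

/-- **Weight components at a point.** Let `F ∈ k[Sym^m]`, `χ` a weight and `p` a point of
`Sym^m` such that `F(t⁻¹ · p) = χ(t) F(p)` for all diagonal `t` — i.e.
`aeval p (t · F) = weightChar χ t * aeval p F`, the relation satisfied at every point of an orbit
by any lift of a `B`-semi-invariant of weight `χ` of the coordinate ring of the orbit closure.
Then the monomials of `F` of torus weight `χ` alone already evaluate to `F(p)`:
`∑_{s : monWeight s = χ} (c_s X^s)(p) = F(p)` (expand `F(t⁻¹ p) = ∑_s t^{monWeight s} (c_s X^s)(p)`
and compare characters, `eq_zero_of_sum_mul_weightChar_eq_zero`). Fulton–Harris §15.5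
(weight decomposition). [folklore] -/
theorem sum_aeval_monomial_filter_monWeight_eq [Infinite k] (F : MvPolynomial (DegIdx σ m) k)
    (χ : Literature.NumberTheory.DiophantineGeometry.Weight σ) (p : DegIdx σ m → k)
    (h : ∀ t : GL σ k, Literature.NumberTheory.DiophantineGeometry.IsDiagonalGL t →
      aeval p (coordRep σ k m t F) = Literature.NumberTheory.DiophantineGeometry.weightChar χ t * aeval p F) :
    ∑ s ∈ F.support.filter (fun s => monWeight s = χ), aeval p (monomial s (coeff s F)) =
      aeval p F := by
  classical
  -- `B s = (c_s X^s)(p)`, grouped by torus weight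
  set B : (DegIdx σ m →₀ ℕ) → k := fun s => aeval p (monomial s (coeff s F)) with hB
  set W : Finset (Literature.NumberTheory.DiophantineGeometry.Weight σ) := insert χ (F.support.image monWeight) with hW
  set Bw : Literature.NumberTheory.DiophantineGeometry.Weight σ → k := fun v => ∑ s ∈ F.support.filter (fun s => monWeight s = v), B s
    with hBw
  have hχW : χ ∈ W := Finset.mem_insert_self _ _
  have hmaps : ∀ s ∈ F.support, monWeight s ∈ W := fun s hs =>
    Finset.mem_insert_of_mem (Finset.mem_image_of_mem _ hs)
  -- expand both sides of `h` in characters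
  have hexp : ∀ t : GL σ k, Literature.NumberTheory.DiophantineGeometry.IsDiagonalGL t →
      aeval p (coordRep σ k m t F) = ∑ v ∈ W, Bw v * Literature.NumberTheory.DiophantineGeometry.weightChar v t := by
    intro t ht
    conv_lhs => rw [← F.support_sum_monomial_coeff, map_sum, map_sum]
    have h1 : ∀ s ∈ F.support, aeval p (coordRep σ k m t (monomial s (coeff s F))) =
        B s * Literature.NumberTheory.DiophantineGeometry.weightChar (monWeight s) t := by
      intro s _
      rw [coordRep_apply, coordSubst_monomial_of_isDiagonalGL ht, map_smul, smul_eq_mul, mul_comm]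
    rw [Finset.sum_congr rfl h1,
      ← Finset.sum_fiberwise_of_maps_to (g := monWeight) (t := W) hmaps]
    refine Finset.sum_congr rfl fun v _ => ?_
    rw [hBw, Finset.sum_mul]
    refine Finset.sum_congr rfl fun s hs => ?_
    rw [(Finset.mem_filter.mp hs).2]
  have hF : aeval p F = ∑ v ∈ W, Bw v := by
    conv_lhs => rw [← F.support_sum_monomial_coeff, map_sum]
    rw [← Finset.sum_fiberwise_of_maps_to (g := monWeight) (t := W) hmaps]
  -- the combination `∑_v (Bw v - [v = χ] F(p)) t^v` vanishes on the torus
  have hcomb : ∀ t : GL σ k, Literature.NumberTheory.DiophantineGeometry.IsDiagonalGL t →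
      ∑ v ∈ W, (Bw v - if v = χ then aeval p F else 0) * Literature.NumberTheory.DiophantineGeometry.weightChar v t = 0 := by
    intro t ht
    simp only [sub_mul, Finset.sum_sub_distrib, ite_mul, zero_mul, Finset.sum_ite_eq',
      if_pos hχW]
    rw [← hexp t ht, h t ht]
    ring
  have := eq_zero_of_sum_mul_weightChar_eq_zero W _ hcomb χ hχW
  rw [if_pos rfl, sub_eq_zero] at this
  exact this

/-- If moreover `F(p) ≠ 0`, some monomial of `F` of torus weight exactly `χ` does not vanish at
`p`. [folklore] -/
theorem exists_monWeight_eq_and_aeval_ne_zero [Infinite k] (F : MvPolynomial (DegIdx σ m) k)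
    (χ : Literature.NumberTheory.DiophantineGeometry.Weight σ) (p : DegIdx σ m → k)
    (h : ∀ t : GL σ k, Literature.NumberTheory.DiophantineGeometry.IsDiagonalGL t →
      aeval p (coordRep σ k m t F) = Literature.NumberTheory.DiophantineGeometry.weightChar χ t * aeval p F)
    (hp : aeval p F ≠ 0) :
    ∃ s ∈ F.support, monWeight s = χ ∧ aeval p (monomial s (1 : k)) ≠ 0 := by
  classical
  rw [← sum_aeval_monomial_filter_monWeight_eq F χ p h] at hp
  obtain ⟨s, hs, hne⟩ := Finset.exists_ne_zero_of_sum_ne_zero hp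
  refine ⟨s, (Finset.mem_filter.mp hs).1, (Finset.mem_filter.mp hs).2, ?_⟩
  intro h0
  apply hne
  rw [← mul_one (coeff s F), ← smul_eq_mul, ← smul_monomial, map_smul, h0, smul_zero]


/-! ### Semi-invariants of the coordinate ring of an orbit closure, evaluated on the orbit -/

section OrbitSemiInvariant

variable {m : ℕ}

/-- **Lifting a highest-weight vector of `k[Δ[f]] = k[Sym^m] ⧸ I(GL · f)`.** A nonzero
`B`-semi-invariant `x` of weight `χ` of the coordinate ring of an orbit closure lifts to a
polynomial `F ∉ I(GL · f)` with `b · F - χ(b) F ∈ I(GL · f)` for every upper triangular `b`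
(no complete reducibility is used: the lift is only semi-invariant modulo the ideal).
BIP §3(b) (occurrence in `ℂ[Z]`); Mulmuley–Sohoni 2001 §5. [folklore] -/
theorem exists_lift_of_mem_highestWeightSpace_orbitCoordRep (f : MvPolynomial σ k) {χ : Literature.NumberTheory.DiophantineGeometry.Weight σ}
    {x : OrbitCoordRing f m} (hx : x ∈ Literature.NumberTheory.DiophantineGeometry.highestWeightSpace (orbitCoordRep f m) χ) (hx0 : x ≠ 0) :
    ∃ F : MvPolynomial (DegIdx σ m) k, F ∉ orbitVanishingIdeal f m ∧
      ∀ b : GL σ k, Literature.NumberTheory.DiophantineGeometry.IsUpperTriangular b →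
        coordSubst m b F - Literature.NumberTheory.DiophantineGeometry.weightChar χ b • F ∈ orbitVanishingIdeal f m := by
  obtain ⟨F, rfl⟩ := Ideal.Quotient.mk_surjective x
  refine ⟨F, fun h => hx0 (Ideal.Quotient.eq_zero_iff_mem.mpr h), fun b hb => ?_⟩
  rw [← Ideal.Quotient.eq]
  have h := hx b hb
  rw [orbitCoordRep_apply, orbitCoordSubst_mk] at h
  rw [h]
  exact (map_smul (Ideal.Quotient.mkₐ k (orbitVanishingIdeal f m)) (Literature.NumberTheory.DiophantineGeometry.weightChar χ b) F).symm

/-- **Semi-invariance on the orbit.** If `b · F - χ(b) F ∈ I(GL · f)` then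
`F(b⁻¹ · q) = χ(b) F(q)` at every point `q = g · f` of the orbit (elements of the ideal vanish on
the orbit, and `(b · F)(q) = F(b⁻¹ · q)`). Mulmuley–Sohoni 2001 §5. [folklore] -/
theorem aeval_formCoeff_inv_eq_of_sub_mem {f : MvPolynomial σ k} {χ : Literature.NumberTheory.DiophantineGeometry.Weight σ}
    {F : MvPolynomial (DegIdx σ m) k} {b : GL σ k}
    (hF : coordSubst m b F - Literature.NumberTheory.DiophantineGeometry.weightChar χ b • F ∈ orbitVanishingIdeal f m) (g : GL σ k) :
    aeval (formCoeff m (linSubstRep σ k b⁻¹ (linSubstRep σ k g f))) F =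
      Literature.NumberTheory.DiophantineGeometry.weightChar χ b * aeval (formCoeff m (linSubstRep σ k g f)) F := by
  have h := mem_orbitVanishingIdeal_iff.mp hF g
  rwa [map_sub, map_smul, sub_eq_zero, aeval_formCoeff_coordSubst, smul_eq_mul] at h

/-- The same in the form `(t · F)(q) = χ(t) F(q)` used by the torus lemma
`exists_monWeight_eq_and_aeval_ne_zero`. [folklore] -/
theorem aeval_formCoeff_coordRep_eq_of_sub_mem {f : MvPolynomial σ k} {χ : Literature.NumberTheory.DiophantineGeometry.Weight σ}
    {F : MvPolynomial (DegIdx σ m) k} {b : GL σ k}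
    (hF : coordSubst m b F - Literature.NumberTheory.DiophantineGeometry.weightChar χ b • F ∈ orbitVanishingIdeal f m) (g : GL σ k) :
    aeval (formCoeff m (linSubstRep σ k g f)) (coordRep σ k m b F) =
      Literature.NumberTheory.DiophantineGeometry.weightChar χ b * aeval (formCoeff m (linSubstRep σ k g f)) F := by
  have h := mem_orbitVanishingIdeal_iff.mp hF g
  rwa [map_sub, map_smul, sub_eq_zero, smul_eq_mul] at h

/-- A polynomial outside `I(GL · f)` does not vanish at some point of the orbit (unfolding of
`mem_orbitVanishingIdeal_iff`). Mulmuley–Sohoni 2001 §4. [folklore] -/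
theorem exists_aeval_formCoeff_ne_zero_of_not_mem {f : MvPolynomial σ k}
    {F : MvPolynomial (DegIdx σ m) k} (hF : F ∉ orbitVanishingIdeal f m) :
    ∃ g : GL σ k, aeval (formCoeff m (linSubstRep σ k g f)) F ≠ 0 := by
  by_contra h
  push Not at h
  exact hF (mem_orbitVanishingIdeal_iff.mpr h)

/-! ### The generic orbit map and generic points of `GL` -/

/-- The *generic orbit map* `k[Sym^m] → k[Mat_σ] = MvPolynomial (σ × σ) k`,
`X_d ↦ coeff_d (Y · f)` with `Y = Matrix.mvPolynomialX σ σ k` the generic matrix: the comorphism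
of the orbit map `A ↦ A · f` (`eval_genericOrbitMap`; written out inline in
`OrbitCoordinateRingProofs.aeval_genericOrbitMap`). Mulmuley–Sohoni 2001 §4.
[cite: MulmuleySohoniSIAM2001, §4] -/
noncomputable def genericOrbitMap (f : MvPolynomial σ k) (m : ℕ) :
    MvPolynomial (DegIdx σ m) k →ₐ[k] MvPolynomial (σ × σ) k :=
  aeval fun d : DegIdx σ m => coeff d.1 (linSubst σ (MvPolynomial (σ × σ) k)
    (Matrix.mvPolynomialX σ σ k) (map (C : k →+* MvPolynomial (σ × σ) k) f))

/-- Evaluating `genericOrbitMap f m F` at a matrix `A` gives `F` at the degree-`m` coefficient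
vector of `A · f`. Mulmuley–Sohoni 2001 §4. [cite: MulmuleySohoniSIAM2001, §4] -/
theorem eval_genericOrbitMap (f : MvPolynomial σ k) (m : ℕ) (F : MvPolynomial (DegIdx σ m) k)
    (A : Matrix σ σ k) :
    eval (fun ij : σ × σ => A ij.1 ij.2) (genericOrbitMap f m F) =
      aeval (formCoeff m (linSubst σ k A f)) F :=
  aeval_genericOrbitMap f m F A

/-- Composing the generic orbit map with a `k`-algebra homomorphism `φ` (e.g. evaluation of
polynomial matrix entries): `φ (genericOrbitMap f m F) = aeval (φ ∘ Y) …`; in particular for a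
matrix `P` of univariate polynomials, `s ↦ F((P(s)) · f)` is the univariate polynomial
`aeval (P entries) (genericOrbitMap f m F)` (`Polynomial.eval_aeval_genericOrbitMap`).
Mulmuley–Sohoni 2001 §4. [folklore] -/
theorem Polynomial.eval_aeval_genericOrbitMap (f : MvPolynomial σ k) (m : ℕ)
    (F : MvPolynomial (DegIdx σ m) k) (P : σ × σ → Polynomial k) (s : k) :
    (aeval P (genericOrbitMap f m F)).eval s =
      aeval (formCoeff m (linSubst σ k (Matrix.of fun i j => (P (i, j)).eval s) f)) F := by
  rw [← Polynomial.coe_aeval_eq_eval, ← AlgHom.comp_apply, comp_aeval, ← eval_genericOrbitMap]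
  simp only [Polynomial.coe_aeval_eq_eval, Matrix.of_apply]
  rfl

/-- Over an infinite field, `I(GL · f)` is the kernel of the generic orbit map
(`orbitVanishingIdeal_eq_ker_genericOrbitMap`), so a polynomial outside the ideal has nonzero
image. Mulmuley–Sohoni 2001 §4. [cite: MulmuleySohoniSIAM2001, §4] -/
theorem genericOrbitMap_ne_zero_of_not_mem [Infinite k] {f : MvPolynomial σ k}
    {F : MvPolynomial (DegIdx σ m) k} (hF : F ∉ orbitVanishingIdeal f m) :
    genericOrbitMap f m F ≠ 0 := by
  rw [orbitVanishingIdeal_eq_ker_genericOrbitMap] at hF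
  exact hF

/-- Over an infinite field a nonzero polynomial on matrix space does not vanish at some
invertible matrix (`GL` is Zariski dense in `Mat`, Mathlib `MvPolynomial.eq_of_eval_eq_on_gl`).
Mulmuley–Sohoni 2001 §4. [folklore] -/
theorem exists_gl_eval_ne_zero [Infinite k] {P : MvPolynomial (σ × σ) k} (hP : P ≠ 0) :
    ∃ g : GL σ k, eval (fun ij : σ × σ => (g : Matrix σ σ k) ij.1 ij.2) P ≠ 0 := by
  by_contra h
  push Not at h
  exact hP (MvPolynomial.eq_of_eval_eq_on_gl fun g => by rw [h g, map_zero])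

/-- **Generic points.** If `F ∉ I(GL · f)` and `Q` is a nonzero polynomial on matrix space, some
`g ∈ GL` has both `F(g · f) ≠ 0` and `Q(g) ≠ 0` (the product of the two nonzero polynomials
`genericOrbitMap f m F` and `Q` on the irreducible variety `Mat` does not vanish on the dense
open `GL`). BIP 2019, proof of Lemma 2.2 / §5 ("for generic `g`"); Mulmuley–Sohoni 2001 §4.
[folklore] -/
theorem exists_gl_aeval_ne_zero_and_eval_ne_zero [Infinite k] {f : MvPolynomial σ k}
    {F : MvPolynomial (DegIdx σ m) k} (hF : F ∉ orbitVanishingIdeal f m)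
    {Q : MvPolynomial (σ × σ) k} (hQ : Q ≠ 0) :
    ∃ g : GL σ k, aeval (formCoeff m (linSubstRep σ k g f)) F ≠ 0 ∧
      eval (fun ij : σ × σ => (g : Matrix σ σ k) ij.1 ij.2) Q ≠ 0 := by
  obtain ⟨g, hg⟩ := exists_gl_eval_ne_zero (mul_ne_zero (genericOrbitMap_ne_zero_of_not_mem hF) hQ)
  rw [map_mul] at hg
  refine ⟨g, ?_, right_ne_zero_of_mul hg⟩
  have h := left_ne_zero_of_mul hg
  rwa [eval_genericOrbitMap] at h

/-! ### Torus weights occurring at a nonvanishing orbit point -/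

/-- **Master lemma.** Let `F` be semi-invariant of weight `χ` modulo `I(GL · f)` (as produced by
`exists_lift_of_mem_highestWeightSpace_orbitCoordRep`) and let `q = g · f` be a point of the
orbit with `F(q) ≠ 0`. Then some monomial `∏_d X_d^{s(d)}` of `F` has torus weight exactly `χ`
(`monWeight s = χ`) and all its coordinate factors are nonzero at `q`: `coeff_d q ≠ 0` for
`d ∈ supp s`. (Torus semi-invariance at the point `q` plus linear independence of characters,
`exists_monWeight_eq_and_aeval_ne_zero`.) This is the mechanism behind BIP Thm. 4.9 and BLMW
(5.2.2). [folklore] -/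
theorem exists_monWeight_eq_of_sub_mem [Infinite k] {f : MvPolynomial σ k} {χ : Literature.NumberTheory.DiophantineGeometry.Weight σ}
    {F : MvPolynomial (DegIdx σ m) k}
    (hF : ∀ b : GL σ k, Literature.NumberTheory.DiophantineGeometry.IsUpperTriangular b →
      coordSubst m b F - Literature.NumberTheory.DiophantineGeometry.weightChar χ b • F ∈ orbitVanishingIdeal f m)
    (g : GL σ k) (hg : aeval (formCoeff m (linSubstRep σ k g f)) F ≠ 0) :
    ∃ s ∈ F.support, monWeight s = χ ∧
      ∀ d ∈ s.support, coeff d.1 (linSubstRep σ k g f) ≠ 0 := by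
  classical
  obtain ⟨s, hs, hw, hne⟩ := exists_monWeight_eq_and_aeval_ne_zero F χ
    (formCoeff m (linSubstRep σ k g f))
    (fun t ht => aeval_formCoeff_coordRep_eq_of_sub_mem (hF t ht.isUpperTriangular) g) hg
  refine ⟨s, hs, hw, fun d hd h0 => hne ?_⟩
  rw [aeval_monomial, map_one, one_mul, Finsupp.prod, Finset.prod_eq_zero hd]
  rw [formCoeff_apply, h0, zero_pow (Finsupp.mem_support_iff.mp hd)]

/-- Occurrence form of the master lemma: if `χ` is a highest weight of `k[Δ_m[f]]` (over an
infinite field) then for some `F ∉ I(GL · f)`, at EVERY orbit point `g · f` with `F(g · f) ≠ 0`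
there is a monomial of torus weight `χ` all of whose coordinates are nonzero at `g · f`; and such
points exist. [folklore] -/
theorem exists_lift_of_hasHighestWeight_orbitCoordRep [Infinite k] (f : MvPolynomial σ k)
    {χ : Literature.NumberTheory.DiophantineGeometry.Weight σ} (h : Literature.NumberTheory.DiophantineGeometry.HasHighestWeight (orbitCoordRep f m) χ) :
    ∃ F : MvPolynomial (DegIdx σ m) k, F ∉ orbitVanishingIdeal f m ∧
      (∀ b : GL σ k, Literature.NumberTheory.DiophantineGeometry.IsUpperTriangular b →
        coordSubst m b F - Literature.NumberTheory.DiophantineGeometry.weightChar χ b • F ∈ orbitVanishingIdeal f m) := by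
  obtain ⟨x, hx0, hx⟩ := (Literature.NumberTheory.DiophantineGeometry.hasHighestWeight_iff_exists _ _).mp h
  exact exists_lift_of_mem_highestWeightSpace_orbitCoordRep f hx hx0

/-! ### Arithmetic of `monWeight` -/

omit [LinearOrder σ] [Field k] in
/-- Torus weights of monomials of `k[Sym^m]` are nonpositive. [folklore] -/
theorem monWeight_nonpos [DecidableEq σ] (s : DegIdx σ m →₀ ℕ) (i : σ) : monWeight s i ≤ 0 := by
  rw [monWeight_apply, neg_nonpos]
  exact Int.natCast_nonneg _

omit [LinearOrder σ] [Field k] in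
/-- Minus the torus weight at `i` counts the occurrences of the variable `x_i` in the monomial.
[folklore] -/
theorem neg_monWeight_apply [DecidableEq σ] (s : DegIdx σ m →₀ ℕ) (i : σ) :
    -monWeight s i = ((∑ d ∈ s.support, s d * d.1 i : ℕ) : ℤ) := by
  rw [monWeight_apply, neg_neg]

omit [LinearOrder σ] [Field k] in
/-- The size of the torus weight of a monomial of degree `D` of `k[Sym^m]` is `-m D` (each
coordinate `X_d` has weight of size `-|d| = -m`). BLMW 2011 §4.4 (a weight pins the degree).
[folklore] -/
theorem size_monWeight [DecidableEq σ] (s : DegIdx σ m →₀ ℕ) :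
    (monWeight s).size = -((m * s.degree : ℕ) : ℤ) := by
  rw [Literature.NumberTheory.DiophantineGeometry.Weight.size]
  simp only [monWeight_apply, Finset.sum_neg_distrib]
  congr 1
  rw [← Nat.cast_sum, Finset.sum_comm, Finsupp.degree_apply, Finset.mul_sum]
  congr 1
  refine Finset.sum_congr rfl fun d _ => ?_
  rw [← Finset.mul_sum, mul_comm]
  congr 1
  have hd : d.1.degree = m := mem_degMonomials_iff.mp d.2
  rw [Finsupp.degree_eq_sum] at hd
  exact hd

omit [LinearOrder σ] [Field k] in
/-- If the variable `x_i` does not occur in any coordinate of the monomial, its torus weight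
vanishes at `i`. [folklore] -/
theorem monWeight_apply_eq_zero [DecidableEq σ] (s : DegIdx σ m →₀ ℕ) {i : σ}
    (h : ∀ d ∈ s.support, d.1 i = 0) : monWeight s i = 0 := by
  rw [monWeight_apply, neg_eq_zero, Nat.cast_eq_zero]
  exact Finset.sum_eq_zero fun d hd => by rw [h d hd, mul_zero]

omit [LinearOrder σ] [Field k] in
/-- If the variable `x_i` occurs at least `r` times in every coordinate of the monomial (of degree
`D`), then `-χ_i ≥ r D` for its torus weight `χ`. [folklore] -/
theorem mul_degree_le_neg_monWeight_apply [DecidableEq σ] (s : DegIdx σ m →₀ ℕ) {i : σ} {r : ℕ}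
    (h : ∀ d ∈ s.support, r ≤ d.1 i) : ((r * s.degree : ℕ) : ℤ) ≤ -monWeight s i := by
  rw [neg_monWeight_apply, Nat.cast_le, Finsupp.degree_apply, Finset.mul_sum]
  exact Finset.sum_le_sum fun d hd => by rw [mul_comm]; exact Nat.mul_le_mul_left _ (h d hd)

end OrbitSemiInvariant


/-! ### The root subgroups `GL₂ ↪ GL_σ` -/

section BlockTwo

variable {R : Type*} [CommRing R]

omit [Fintype σ] in
/-- The block embedding of a `2 × 2` matrix `B` at two positions `i ≠ j` of `σ`: rows and
columns `i, j` carry `B`, the other coordinates carry the identity matrix (the subgroup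
`GL₂ ⊂ GL_N` attached to the pair of indices `(i, j)`). Fulton–Harris §15.1;
Goodman–Wallach §2.4.1. [folklore] -/
def blockTwo (i j : σ) (B : Matrix (Fin 2) (Fin 2) R) : Matrix σ σ R :=
  Matrix.of fun x y =>
    if x = i then (if y = i then B 0 0 else if y = j then B 0 1 else 0)
    else if x = j then (if y = i then B 1 0 else if y = j then B 1 1 else 0)
    else if x = y then 1 else 0

omit [Fintype σ] in
/-- Unfolding lemma for `blockTwo`. [folklore] -/
theorem blockTwo_apply (i j : σ) (B : Matrix (Fin 2) (Fin 2) R) (x y : σ) :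
    blockTwo i j B x y =
      if x = i then (if y = i then B 0 0 else if y = j then B 0 1 else 0)
      else if x = j then (if y = i then B 1 0 else if y = j then B 1 1 else 0)
      else if x = y then 1 else 0 :=
  rfl

/-- A two-point sum. [folklore] -/
theorem sum_ite_ite_mul {i j : σ} (hij : i ≠ j) (a b : R) (φ : σ → R) :
    ∑ z, (if z = i then a else if z = j then b else 0) * φ z = a * φ i + b * φ j := by
  have h : ∀ z, (if z = i then a else if z = j then b else 0) * φ z =
      (if z = i then a * φ z else 0) + (if z = j then b * φ z else 0) := by
    intro z
    by_cases hzi : z = i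
    · subst hzi
      rw [if_pos rfl, if_pos rfl, if_neg hij, add_zero]
    · by_cases hzj : z = j
      · subst hzj
        rw [if_neg hzi, if_pos rfl, if_neg hzi, if_pos rfl, zero_add]
      · rw [if_neg hzi, if_neg hzj, if_neg hzi, if_neg hzj, zero_mul, add_zero]
  simp_rw [h]
  rw [Finset.sum_add_distrib, Finset.sum_ite_eq', Finset.sum_ite_eq', if_pos (Finset.mem_univ _),
    if_pos (Finset.mem_univ _)]

/-- The rows of `blockTwo i j B` act on a column vector `φ` through the `2 × 2` block.
[folklore] -/
theorem sum_blockTwo_mul {i j : σ} (hij : i ≠ j) (B : Matrix (Fin 2) (Fin 2) R)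
    (x : σ) (φ : σ → R) :
    ∑ z, blockTwo i j B x z * φ z =
      if x = i then B 0 0 * φ i + B 0 1 * φ j
      else if x = j then B 1 0 * φ i + B 1 1 * φ j else φ x := by
  by_cases hxi : x = i
  · simp only [blockTwo_apply, if_pos hxi]
    exact sum_ite_ite_mul hij _ _ φ
  · by_cases hxj : x = j
    · simp only [blockTwo_apply, if_neg hxi, if_pos hxj]
      exact sum_ite_ite_mul hij _ _ φ
    · simp only [blockTwo_apply, if_neg hxi, if_neg hxj, ite_mul, one_mul, zero_mul,
        Finset.sum_ite_eq, Finset.mem_univ, if_true]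

/-- `blockTwo i j` is multiplicative (`i ≠ j`). Fulton–Harris §15.1. [folklore] -/
theorem blockTwo_mul {i j : σ} (hij : i ≠ j) (B B' : Matrix (Fin 2) (Fin 2) R) :
    blockTwo i j B * blockTwo i j B' = blockTwo i j (B * B') := by
  ext x y
  rw [Matrix.mul_apply, sum_blockTwo_mul hij]
  simp only [blockTwo_apply, Matrix.mul_apply, Fin.sum_univ_two, if_true, if_neg hij,
    if_neg hij.symm]
  by_cases hxi : x = i
  · simp only [if_pos hxi]
    split_ifs <;> ring
  · simp only [if_neg hxi]
    by_cases hxj : x = j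
    · simp only [if_pos hxj]
      split_ifs <;> ring
    · simp only [if_neg hxj]

omit [Fintype σ] in
/-- `blockTwo i j 1 = 1` (`i ≠ j`). [folklore] -/
theorem blockTwo_one {i j : σ} (hij : i ≠ j) :
    blockTwo i j (1 : Matrix (Fin 2) (Fin 2) R) = 1 := by
  ext x y
  simp only [blockTwo_apply, Matrix.one_apply, if_true,
    show (0 : Fin 2) ≠ 1 from by decide, show (1 : Fin 2) ≠ 0 from by decide, if_false]
  by_cases hxi : x = i
  · subst hxi
    simp only [if_true]
    by_cases hyi : y = x
    · subst hyi; simp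
    · rw [if_neg hyi, if_neg (Ne.symm hyi)]
      split_ifs <;> rfl
  · rw [if_neg hxi]
    by_cases hxj : x = j
    · subst hxj
      simp only [if_true]
      by_cases hyi : y = i
      · subst hyi; rw [if_pos rfl, if_neg hxi]
      · rw [if_neg hyi]
        by_cases hyx : y = x
        · subst hyx; simp
        · rw [if_neg hyx, if_neg (Ne.symm hyx)]
    · rw [if_neg hxj]

omit [Fintype σ] in
/-- `blockTwo` commutes with entrywise maps fixing `0` and `1` (e.g. evaluation of polynomial
entries). [folklore] -/
theorem blockTwo_map {R' : Type*} [CommRing R'] (i j : σ)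
    (B : Matrix (Fin 2) (Fin 2) R) (φ : R → R') (h0 : φ 0 = 0) (h1 : φ 1 = 1) :
    (blockTwo i j B).map φ = blockTwo i j (B.map φ) := by
  ext x y
  simp only [Matrix.map_apply, blockTwo_apply]
  split_ifs <;> simp [h0, h1]

/-- The block embedding on invertible `2 × 2` matrices, `GL₂ → GL_σ` (`i ≠ j`).
Fulton–Harris §15.1. [folklore] -/
def blockTwoGL {i j : σ} (hij : i ≠ j) (B : GL (Fin 2) R) : GL σ R :=
  ⟨blockTwo i j (B : Matrix (Fin 2) (Fin 2) R), blockTwo i j ((B⁻¹ : GL (Fin 2) R) : Matrix _ _ R),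
    by rw [blockTwo_mul hij, Units.mul_inv, blockTwo_one hij],
    by rw [blockTwo_mul hij, Units.inv_mul, blockTwo_one hij]⟩

/-- The matrix of `blockTwoGL hij B`. [folklore] -/
@[simp]
theorem coe_blockTwoGL {i j : σ} (hij : i ≠ j) (B : GL (Fin 2) R) :
    ((blockTwoGL hij B : GL σ R) : Matrix σ σ R) = blockTwo i j (B : Matrix (Fin 2) (Fin 2) R) :=
  rfl

/-- The matrix of the inverse of `blockTwoGL hij B`. [folklore] -/
@[simp]
theorem coe_inv_blockTwoGL {i j : σ} (hij : i ≠ j) (B : GL (Fin 2) R) :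
    (((blockTwoGL hij B)⁻¹ : GL σ R) : Matrix σ σ R) =
      blockTwo i j ((B⁻¹ : GL (Fin 2) R) : Matrix (Fin 2) (Fin 2) R) :=
  rfl

/-- `blockTwoGL hij` is a group homomorphism. Fulton–Harris §15.1. [folklore] -/
theorem blockTwoGL_mul {i j : σ} (hij : i ≠ j) (B B' : GL (Fin 2) R) :
    blockTwoGL hij B * blockTwoGL hij B' = (blockTwoGL hij (B * B') : GL σ R) :=
  Units.ext (by simp [blockTwo_mul hij])

/-- For `i < j`, the image of an upper triangular `2 × 2` matrix is upper triangular.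
Fulton–Harris §15.1. [folklore] -/
theorem isUpperTriangular_blockTwoGL {K : Type*} [Field K] {i j : σ} (hij : i < j)
    (B : GL (Fin 2) K) (hB : (B : Matrix (Fin 2) (Fin 2) K) 1 0 = 0) :
    Literature.NumberTheory.DiophantineGeometry.IsUpperTriangular (blockTwoGL hij.ne B : GL σ K) := by
  intro x y hyx
  change blockTwo i j (B : Matrix (Fin 2) (Fin 2) K) x y = 0
  change y < x at hyx
  rw [blockTwo_apply]
  by_cases hxi : x = i
  · subst hxi
    rw [if_pos rfl, if_neg hyx.ne, if_neg (hyx.trans hij).ne]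
  · rw [if_neg hxi]
    by_cases hxj : x = j
    · subst hxj
      rw [if_pos rfl]
      by_cases hyi : y = i
      · rw [if_pos hyi, hB]
      · rw [if_neg hyi, if_neg hyx.ne]
    · rw [if_neg hxj, if_neg (Ne.symm hyx.ne)]

/-- The weight character on the image of `GL₂`: `χ(blockTwo B) = B₀₀^{χ_i} B₁₁^{χ_j}`.
Fulton–Harris §15.1. [folklore] -/
theorem weightChar_blockTwoGL {K : Type*} [Field K] {i j : σ} (hij : i ≠ j) (χ : Literature.NumberTheory.DiophantineGeometry.Weight σ)
    (B : GL (Fin 2) K) :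
    Literature.NumberTheory.DiophantineGeometry.weightChar χ (blockTwoGL hij B : GL σ K) =
      (B : Matrix (Fin 2) (Fin 2) K) 0 0 ^ χ i * (B : Matrix (Fin 2) (Fin 2) K) 1 1 ^ χ j := by
  rw [Literature.NumberTheory.DiophantineGeometry.weightChar, coe_blockTwoGL]
  have h : ∀ x, blockTwo i j (B : Matrix (Fin 2) (Fin 2) K) x x ^ χ x =
      (if x = i then (B : Matrix (Fin 2) (Fin 2) K) 0 0 ^ χ i else 1) *
        (if x = j then (B : Matrix (Fin 2) (Fin 2) K) 1 1 ^ χ j else 1) := by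
    intro x
    rw [blockTwo_apply]
    by_cases hxi : x = i
    · subst hxi
      simp [hij]
    · by_cases hxj : x = j
      · subst hxj
        simp [hxi]
      · simp [hxi, hxj]
  simp_rw [h]
  rw [Finset.prod_mul_distrib, Finset.prod_ite_eq', Finset.prod_ite_eq', if_pos (Finset.mem_univ _),
    if_pos (Finset.mem_univ _)]

end BlockTwo

/-! ### Dominance of occurring weights -/

section Dominance

variable {m : ℕ}

/-- A univariate identity forcing a constant term to vanish: if `G(s) sⁿ = ψ(1/s)` for all
`s ≠ 0` in an infinite field, with `n ≥ 1`, then `ψ(0) = 0` (compare the coefficient of `s^D`,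
`D = deg ψ`, in `s^{D+n} G(s) = s^D ψ(1/s)`). [folklore] -/
theorem Polynomial.eval_zero_eq_zero_of_mul_pow_eq_eval_inv {K : Type*} [Field K] [Infinite K]
    {G ψ : Polynomial K} {n : ℕ} (hn : 1 ≤ n)
    (h : ∀ s : K, s ≠ 0 → G.eval s * s ^ n = ψ.eval s⁻¹) : ψ.eval 0 = 0 := by
  set D := ψ.natDegree with hD
  -- the reversed polynomial `R(s) = s^D ψ(1/s)`
  set R : Polynomial K :=
    ∑ t ∈ Finset.range (D + 1), Polynomial.C (ψ.coeff t) * Polynomial.X ^ (D - t) with hR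
  have hReval : ∀ s : K, s ≠ 0 → R.eval s = s ^ D * ψ.eval s⁻¹ := by
    intro s hs
    rw [hR, Polynomial.eval_finsetSum, Polynomial.eval_eq_sum_range (p := ψ) s⁻¹, Finset.mul_sum]
    refine Finset.sum_congr rfl fun t ht => ?_
    have ht' : t ≤ D := Nat.lt_succ_iff.mp (Finset.mem_range.mp ht)
    simp only [Polynomial.eval_mul, Polynomial.eval_C, Polynomial.eval_pow, Polynomial.eval_X]
    rw [pow_sub₀ s hs ht', inv_pow]
    ring
  have hRG : R = Polynomial.X ^ (D + n) * G := by
    apply Polynomial.eq_of_infinite_eval_eq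
    apply Set.Infinite.mono (s := {x : K | x ≠ 0})
    · intro s hs
      have hs : s ≠ 0 := hs
      simp only [Set.mem_setOf_eq, Polynomial.eval_mul, Polynomial.eval_pow, Polynomial.eval_X]
      rw [hReval s hs, ← h s hs]
      ring
    · have : ({x : K | x ≠ 0}) = ({0} : Set K)ᶜ := by
        ext x; simp
      rw [this]
      exact (Set.finite_singleton (0 : K)).infinite_compl
  have hcoeff : R.coeff D = (Polynomial.X ^ (D + n) * G).coeff D := by rw [hRG]
  rw [Polynomial.coeff_X_pow_mul', if_neg (by omega), hR, Polynomial.finsetSum_coeff,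
    Finset.sum_eq_single 0] at hcoeff
  · rw [Nat.sub_zero, Polynomial.coeff_C_mul, Polynomial.coeff_X_pow, if_pos rfl, mul_one]
      at hcoeff
    rw [← Polynomial.coeff_zero_eq_eval_zero, hcoeff]
  · intro t ht ht0
    have ht' : t ≤ D := Nat.lt_succ_iff.mp (Finset.mem_range.mp ht)
    rw [Polynomial.coeff_C_mul, Polynomial.coeff_X_pow, if_neg (by omega), mul_zero]
  · intro h0
    exact absurd (Finset.mem_range.mpr (Nat.succ_pos D)) h0

/-- The `2 × 2` matrices used to probe the pair `(i, j)`: `A(s) = (0, -1; 1, s)`, with inverse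
`(s, 1; -1, 0)`. [folklore] -/
theorem aTwo_mul_inv {K : Type*} [Field K] (s : K) :
    !![(0 : K), -1; 1, s] * !![s, 1; -1, 0] = 1 ∧ !![s, (1 : K); -1, 0] * !![0, -1; 1, s] = 1 := by
  constructor <;> simp [Matrix.one_fin_two]

/-- The Borel factor `b(s) = (s⁻¹, -1; 0, s)` with inverse `(s, 1; 0, s⁻¹)`, `s ≠ 0`.
[folklore] -/
theorem bTwo_mul_inv {K : Type*} [Field K] {s : K} (hs : s ≠ 0) :
    !![s⁻¹, (-1 : K); 0, s] * !![s, 1; 0, s⁻¹] = 1 ∧ !![s, (1 : K); 0, s⁻¹] * !![s⁻¹, -1; 0, s] = 1 := by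
  constructor <;> simp [Matrix.one_fin_two, hs]

/-- The Bruhat-type factorisation `b(s)⁻¹ A(s) = u(s⁻¹) = (1, 0; s⁻¹, 1)` (lower unipotent).
[folklore] -/
theorem bTwo_inv_mul_aTwo {K : Type*} [Field K] {s : K} (hs : s ≠ 0) :
    !![s, (1 : K); 0, s⁻¹] * !![0, -1; 1, s] = !![1, 0; s⁻¹, 1] := by
  simp [hs]

/-- **Occurring weights are dominant.** Over an infinite field, every highest weight `χ` of the
coordinate ring `k[Δ_m[f]]` of an orbit closure is dominant (weakly decreasing along the order
of `σ`). Classical for rational `GL`-modules (Fulton–Harris Prop. 15.15 / §15.5; Goodman–Wallach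
Thm. 3.2.5); proved here directly on the orbit without complete reducibility: for `i < j` the
lift `F` of a semi-invariant satisfies `F(A(s) · q) = s^{χ_i - χ_j} F(u(1/s) · q)` along the
`GL₂ ⊂ GL_σ` at `(i, j)` (`A(s) = b(s) u(1/s)`, `b(s)` upper triangular with diagonal
`(1/s, s)`), both sides polynomial in `s` resp. `1/s` with `F(u(0) · q) = F(q) ≠ 0`, which forces
`χ_i ≥ χ_j` (`Polynomial.eval_zero_eq_zero_of_mul_pow_eq_eval_inv`). [folklore] -/
theorem isDominant_of_hasHighestWeight_orbitCoordRep [Infinite k] (f : MvPolynomial σ k)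
    {χ : Literature.NumberTheory.DiophantineGeometry.Weight σ} (h : Literature.NumberTheory.DiophantineGeometry.HasHighestWeight (orbitCoordRep f m) χ) : χ.IsDominant := by
  obtain ⟨F, hFI, hF⟩ := exists_lift_of_hasHighestWeight_orbitCoordRep f h
  obtain ⟨g₀, hg₀⟩ := exists_aeval_formCoeff_ne_zero_of_not_mem hFI
  intro i j hij
  rcases hij.lt_or_eq with hlt | rfl
  swap
  · exact le_rfl
  by_contra hcon
  push Not at hcon
  -- `n = χ j - χ i ≥ 1`
  obtain ⟨n, hn1, hn⟩ : ∃ n : ℕ, 1 ≤ n ∧ (χ j - χ i : ℤ) = n :=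
    ⟨(χ j - χ i).toNat, by omega, (Int.toNat_of_nonneg (by omega)).symm⟩
  -- the base point `q = g₀ · f` and the two one-parameter families, as polynomials in `s`
  set q : MvPolynomial σ k := linSubstRep σ k g₀ f with hq
  set AP : Matrix (Fin 2) (Fin 2) (Polynomial k) := !![0, -1; 1, Polynomial.X] with hAP
  set UP : Matrix (Fin 2) (Fin 2) (Polynomial k) := !![1, 0; Polynomial.X, 1] with hUP
  set G : Polynomial k :=
    aeval (fun ij : σ × σ => blockTwo i j AP ij.1 ij.2) (genericOrbitMap q m F) with hG
  set ψ : Polynomial k :=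
    aeval (fun ij : σ × σ => blockTwo i j UP ij.1 ij.2) (genericOrbitMap q m F) with hψ
  have hAP_eval : ∀ s : k, (Matrix.of fun x y => (blockTwo i j AP (x, y).1 (x, y).2).eval s) =
      blockTwo i j !![(0 : k), -1; 1, s] := by
    intro s
    change (blockTwo i j AP).map (Polynomial.eval s) = _
    rw [blockTwo_map i j AP (Polynomial.eval s) (Polynomial.eval_zero) (Polynomial.eval_one)]
    congr 1
    ext a b
    fin_cases a <;> fin_cases b <;> simp [hAP]
  have hUP_eval : ∀ c : k, (Matrix.of fun x y => (blockTwo i j UP (x, y).1 (x, y).2).eval c) =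
      blockTwo i j !![(1 : k), 0; c, 1] := by
    intro c
    change (blockTwo i j UP).map (Polynomial.eval c) = _
    rw [blockTwo_map i j UP (Polynomial.eval c) (Polynomial.eval_zero) (Polynomial.eval_one)]
    congr 1
    ext a b
    fin_cases a <;> fin_cases b <;> simp [hUP]
  have hGeval : ∀ s : k, G.eval s =
      aeval (formCoeff m (linSubst σ k (blockTwo i j !![(0 : k), -1; 1, s]) q)) F := by
    intro s
    rw [hG, Polynomial.eval_aeval_genericOrbitMap, hAP_eval]
  have hψeval : ∀ c : k, ψ.eval c =
      aeval (formCoeff m (linSubst σ k (blockTwo i j !![(1 : k), 0; c, 1]) q)) F := by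
    intro c
    rw [hψ, Polynomial.eval_aeval_genericOrbitMap, hUP_eval]
  -- `ψ(0) = F(q) ≠ 0`
  have hψ0 : ψ.eval 0 ≠ 0 := by
    rw [hψeval, show (!![(1 : k), 0; 0, 1] : Matrix (Fin 2) (Fin 2) k) = 1 from
      (Matrix.one_fin_two).symm, blockTwo_one hlt.ne, linSubst_one, AlgHom.id_apply]
    exact hg₀
  -- the key identity `G(s) sⁿ = ψ(1/s)` for `s ≠ 0`
  have key : ∀ s : k, s ≠ 0 → G.eval s * s ^ n = ψ.eval s⁻¹ := by
    intro s hs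
    -- the `GL` elements `A(s)`, `b(s)`
    let aU : GL (Fin 2) k := ⟨!![0, -1; 1, s], !![s, 1; -1, 0], (aTwo_mul_inv s).1, (aTwo_mul_inv s).2⟩
    let bU : GL (Fin 2) k :=
      ⟨!![s⁻¹, -1; 0, s], !![s, 1; 0, s⁻¹], (bTwo_mul_inv hs).1, (bTwo_mul_inv hs).2⟩
    have hbU : Literature.NumberTheory.DiophantineGeometry.IsUpperTriangular (blockTwoGL hlt.ne bU : GL σ k) :=
      isUpperTriangular_blockTwoGL hlt bU (by simp [bU])
    -- semi-invariance at the orbit point `A(s) g₀ · f` for the Borel element `b(s)`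
    have h1 := aeval_formCoeff_inv_eq_of_sub_mem (hF _ hbU) (blockTwoGL hlt.ne aU * g₀)
    -- the left-hand side is `ψ(1/s)`
    have hlhs : linSubstRep σ k (blockTwoGL hlt.ne bU)⁻¹
        (linSubstRep σ k (blockTwoGL hlt.ne aU * g₀) f) =
        linSubst σ k (blockTwo i j !![(1 : k), 0; s⁻¹, 1]) q := by
      have hmat : ((bU⁻¹ : GL (Fin 2) k) : Matrix (Fin 2) (Fin 2) k) * (aU : Matrix (Fin 2) (Fin 2) k) =
          !![1, 0; s⁻¹, 1] := bTwo_inv_mul_aTwo hs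
      rw [← Module.End.mul_apply, ← map_mul, ← mul_assoc, map_mul, Module.End.mul_apply,
        ← hq, linSubstRep_apply, Units.val_mul, coe_inv_blockTwoGL, coe_blockTwoGL,
        blockTwo_mul hlt.ne, hmat]
    -- the right-hand side is `χ(b(s)) G(s)` with `χ(b(s)) = s^{χ_j - χ_i} = sⁿ`
    have hrhs : linSubstRep σ k (blockTwoGL hlt.ne aU * g₀) f =
        linSubst σ k (blockTwo i j !![(0 : k), -1; 1, s]) q := by
      rw [map_mul, Module.End.mul_apply, ← hq, linSubstRep_apply, coe_blockTwoGL]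
    have hchar : Literature.NumberTheory.DiophantineGeometry.weightChar χ (blockTwoGL hlt.ne bU : GL σ k) = s ^ n := by
      rw [weightChar_blockTwoGL]
      change (s⁻¹) ^ χ i * s ^ χ j = s ^ n
      rw [inv_zpow', ← zpow_add₀ hs, ← zpow_natCast]
      congr 1
      omega
    rw [hlhs, hrhs, hchar, ← hGeval, ← hψeval] at h1
    rw [h1, mul_comm]
  exact hψ0 (Polynomial.eval_zero_eq_zero_of_mul_pow_eq_eval_inv hn1 key)

end Dominance


/-! ### The partition form of occurring weights (BLMW (5.2.2)) -/

section PartitionForm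

variable {m : ℕ}

/-- **Nonpositivity and size of occurring weights.** Over an infinite field, a highest weight
`χ` of `k[Δ_m[f]]` is the torus weight of a monomial of `k[Sym^m]`: `χ ≤ 0` entrywise and
`|χ| = -m D` for the degree `D` of that monomial (a weight pins the degree, BLMW 2011 §4.4,
(5.2.2)). [folklore] -/
theorem nonpos_and_exists_size_eq_of_hasHighestWeight_orbitCoordRep [Infinite k]
    (f : MvPolynomial σ k) {χ : Literature.NumberTheory.DiophantineGeometry.Weight σ} (h : Literature.NumberTheory.DiophantineGeometry.HasHighestWeight (orbitCoordRep f m) χ) :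
    (∀ i, χ i ≤ 0) ∧ ∃ D : ℕ, χ.size = -((m * D : ℕ) : ℤ) := by
  classical
  obtain ⟨F, hFI, hF⟩ := exists_lift_of_hasHighestWeight_orbitCoordRep f h
  obtain ⟨g, hg⟩ := exists_aeval_formCoeff_ne_zero_of_not_mem hFI
  obtain ⟨s, _, hw, _⟩ := exists_monWeight_eq_of_sub_mem hF g hg
  subst hw
  exact ⟨monWeight_nonpos s, s.degree, size_monWeight s⟩

/-- The size of the dual weight is minus the size. Fulton–Harris Ex. 15.50. [folklore] -/
theorem _root_.Literature.NumberTheory.DiophantineGeometry.Weight.size_dual {N : ℕ} (χ : Literature.NumberTheory.DiophantineGeometry.Weight (Fin N)) : χ.dual.size = -χ.size := by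
  rw [Literature.NumberTheory.DiophantineGeometry.Weight.size, Literature.NumberTheory.DiophantineGeometry.Weight.size]
  simp only [Literature.NumberTheory.DiophantineGeometry.Weight.dual, Finset.sum_neg_distrib]
  rw [Fintype.sum_equiv Fin.revPerm (fun i => χ (Fin.rev i)) χ (fun _ => rfl)]

/-- A nonpositive dominant weight on `Fin N` of size `-m D` is the dual weight of a partition
`λ ⊢ D·m` with at most `N` parts (its dual is polynomial of size `m D`;
`Weight.existsUnique_eq_ofPartition_holds`). Fulton–Harris §15.5, Ex. 15.50. [folklore] -/
theorem _root_.Literature.NumberTheory.DiophantineGeometry.Weight.exists_eq_dualOfPartition_of_nonpos {N m D : ℕ} (χ : Literature.NumberTheory.DiophantineGeometry.Weight (Fin N))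
    (hnonpos : ∀ i, χ i ≤ 0) (hdom : χ.IsDominant) (hsize : χ.size = -((m * D : ℕ) : ℤ)) :
    ∃ lam : Nat.Partition (D * m), lam.parts.card ≤ N ∧ χ = Literature.NumberTheory.DiophantineGeometry.Weight.dualOfPartition N lam := by
  have hpol : χ.dual.IsPolynomial :=
    ⟨hdom.dual, fun i => by rw [Literature.NumberTheory.DiophantineGeometry.Weight.dual]; exact neg_nonneg.mpr (hnonpos _)⟩
  obtain ⟨μ, ⟨hμN, hμ⟩, -⟩ := Literature.NumberTheory.DiophantineGeometry.Weight.existsUnique_eq_ofPartition_holds hpol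
  have hdsize : χ.dual.size.toNat = D * m := by
    rw [Literature.NumberTheory.DiophantineGeometry.Weight.size_dual, hsize, neg_neg, Int.toNat_natCast, mul_comm]
  refine ⟨⟨μ.parts, μ.parts_pos, by rw [μ.parts_sum, hdsize]⟩, hμN, ?_⟩
  have hof : Literature.NumberTheory.DiophantineGeometry.Weight.ofPartition N (⟨μ.parts, μ.parts_pos, by rw [μ.parts_sum, hdsize]⟩ :
      Nat.Partition (D * m)) = Literature.NumberTheory.DiophantineGeometry.Weight.ofPartition N μ := rfl
  rw [Literature.NumberTheory.DiophantineGeometry.Weight.dualOfPartition, hof, hμ, Literature.NumberTheory.DiophantineGeometry.Weight.dual_dual]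

/-- The same for a weight on any finite linear order `σ`, enumerated increasingly by
`e : Fin N ≃o σ`: `χ = λ^* ∘ e⁻¹`. [folklore] -/
theorem _root_.Literature.NumberTheory.DiophantineGeometry.Weight.exists_eq_dualOfPartition_comp_of_nonpos {N m D : ℕ} (e : Fin N ≃o σ)
    (χ : Literature.NumberTheory.DiophantineGeometry.Weight σ) (hnonpos : ∀ i, χ i ≤ 0) (hdom : χ.IsDominant)
    (hsize : χ.size = -((m * D : ℕ) : ℤ)) :
    ∃ lam : Nat.Partition (D * m), lam.parts.card ≤ N ∧
      χ = fun x => Literature.NumberTheory.DiophantineGeometry.Weight.dualOfPartition N lam (e.symm x) := by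
  have hdom' : Literature.NumberTheory.DiophantineGeometry.Weight.IsDominant (χ ∘ e : Literature.NumberTheory.DiophantineGeometry.Weight (Fin N)) := hdom.comp_monotone e.monotone
  have hsize' : Literature.NumberTheory.DiophantineGeometry.Weight.size (χ ∘ e : Literature.NumberTheory.DiophantineGeometry.Weight (Fin N)) = -((m * D : ℕ) : ℤ) := by
    rw [← hsize, Literature.NumberTheory.DiophantineGeometry.Weight.size, Literature.NumberTheory.DiophantineGeometry.Weight.size]
    exact e.toEquiv.sum_comp χ
  obtain ⟨lam, hlamN, hlam⟩ :=
    Literature.NumberTheory.DiophantineGeometry.Weight.exists_eq_dualOfPartition_of_nonpos (χ ∘ e) (fun i => hnonpos _) hdom' hsize'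
  refine ⟨lam, hlamN, funext fun x => ?_⟩
  rw [← hlam, Function.comp_apply, OrderIso.apply_symm_apply]

/-- **Highest weights of `k[Δ_m[f]]` are duals of partitions (BLMW (5.2.2)), for a prescribed
degree.** Over an infinite field, if `χ` is a highest weight of the coordinate ring of the orbit
closure of `f ∈ k[x_σ]` (`σ` enumerated increasingly by `e : Fin N ≃o σ`) and `|χ| = -m D`, then
`χ = λ^* ∘ e⁻¹` for a partition `λ ⊢ D·m` with at most `N = dim V` parts. BLMW 2011 (5.2.2);
Fulton–Harris §15.5. Proved without complete reducibility (dominance: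
`isDominant_of_hasHighestWeight_orbitCoordRep`). [cite: BurgisserEtAl2011, (5.2.2)] -/
theorem exists_eq_dualOfPartition_of_hasHighestWeight_orbitCoordRep_of_size_eq [Infinite k]
    {N D : ℕ} (e : Fin N ≃o σ) (f : MvPolynomial σ k) {χ : Literature.NumberTheory.DiophantineGeometry.Weight σ}
    (h : Literature.NumberTheory.DiophantineGeometry.HasHighestWeight (orbitCoordRep f m) χ) (hsize : χ.size = -((m * D : ℕ) : ℤ)) :
    ∃ lam : Nat.Partition (D * m), lam.parts.card ≤ N ∧
      χ = fun x => Literature.NumberTheory.DiophantineGeometry.Weight.dualOfPartition N lam (e.symm x) :=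
  Literature.NumberTheory.DiophantineGeometry.Weight.exists_eq_dualOfPartition_comp_of_nonpos e χ
    (nonpos_and_exists_size_eq_of_hasHighestWeight_orbitCoordRep f h).1
    (isDominant_of_hasHighestWeight_orbitCoordRep f h) hsize

/-- **Highest weights of `k[Δ_m[f]]` are duals of partitions (BLMW (5.2.2)).** Over an infinite
field, every highest weight of the coordinate ring of the orbit closure of `f ∈ k[x_σ]`
(`σ` enumerated increasingly by `e : Fin N ≃o σ`) is `λ^* ∘ e⁻¹` for a partition `λ ⊢ D·m`
(`D` the degree) with at most `N` parts. BLMW 2011 §4.4, (5.2.2); Fulton–Harris §15.5.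
[cite: BurgisserEtAl2011, (5.2.2)] -/
theorem exists_eq_dualOfPartition_of_hasHighestWeight_orbitCoordRep [Infinite k] {N : ℕ}
    (e : Fin N ≃o σ) (f : MvPolynomial σ k) {χ : Literature.NumberTheory.DiophantineGeometry.Weight σ}
    (h : Literature.NumberTheory.DiophantineGeometry.HasHighestWeight (orbitCoordRep f m) χ) :
    ∃ (D : ℕ) (lam : Nat.Partition (D * m)), lam.parts.card ≤ N ∧
      χ = fun x => Literature.NumberTheory.DiophantineGeometry.Weight.dualOfPartition N lam (e.symm x) := by
  obtain ⟨D, hD⟩ := (nonpos_and_exists_size_eq_of_hasHighestWeight_orbitCoordRep f h).2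
  exact ⟨D, exists_eq_dualOfPartition_of_hasHighestWeight_orbitCoordRep_of_size_eq e f h hD⟩

/-! ### Reading off a partition from its dual weight -/

/-- The last entry of the dual weight of `λ` is `-λ₁` (minus the largest part, the head of the
sorted parts). Fulton–Harris Ex. 15.50. [folklore] -/
theorem _root_.Literature.NumberTheory.DiophantineGeometry.Weight.dualOfPartition_apply_last {N d : ℕ} (lam : Nat.Partition d) (hN : 0 < N) :
    Literature.NumberTheory.DiophantineGeometry.Weight.dualOfPartition N lam ⟨N - 1, Nat.sub_one_lt_of_lt hN⟩ =
      -((lam.sortedParts.getD 0 0 : ℕ) : ℤ) := by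
  rw [Literature.NumberTheory.DiophantineGeometry.Weight.dualOfPartition, Literature.NumberTheory.DiophantineGeometry.Weight.dual, Literature.NumberTheory.DiophantineGeometry.Weight.ofPartition_apply]
  congr 3
  simp [Fin.rev]
  omega

/-- If the dual weight of `λ` (with at most `N` parts) vanishes at all indices `i` with
`i + L < N` (the bottom `N - L` indices), then `λ` has at most `L` parts. [folklore] -/
theorem card_parts_le_of_dualOfPartition_apply_eq_zero {N d L : ℕ} (lam : Nat.Partition d)
    (hN : lam.parts.card ≤ N)
    (h : ∀ i : Fin N, (i : ℕ) + L < N → Literature.NumberTheory.DiophantineGeometry.Weight.dualOfPartition N lam i = 0) :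
    lam.parts.card ≤ L := by
  by_contra hL
  rw [not_le] at hL
  have hLN : L < N := lt_of_lt_of_le hL hN
  have key := h ⟨N - 1 - L, by omega⟩ (by simp; omega)
  rw [Literature.NumberTheory.DiophantineGeometry.Weight.dualOfPartition, Literature.NumberTheory.DiophantineGeometry.Weight.dual, Literature.NumberTheory.DiophantineGeometry.Weight.ofPartition_apply, neg_eq_zero,
    Nat.cast_eq_zero] at key
  have hrev : ((Fin.rev (⟨N - 1 - L, by omega⟩ : Fin N) : Fin N) : ℕ) = L := by
    simp [Fin.rev]; omega
  rw [hrev, List.getD_eq_getElem _ _ (by simpa using hL)] at key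
  exact (lam.pos_of_mem_sortedParts (List.getElem_mem (by simpa using hL))).ne' key

end PartitionForm

/-! ### BIP Thm. 4.9(2): the first row of weights occurring for padded forms -/

section FirstRow

variable {m : ℕ}

/-- The Borel element moving `X_{iₘ}` (`iₘ` the greatest index) to a linear form `ℓ` with
`ℓ_{iₘ} ≠ 0` and fixing the other variables: column `iₘ` is `ℓ`, the rest is the identity.
It is upper triangular with determinant `ℓ_{iₘ}`. [folklore] -/
theorem isUpperTriangular_and_det_of_col_last (iₘ : σ) (hiₘ : ∀ i, i ≤ iₘ) (ℓ : σ → k) :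
    (Matrix.of fun x y : σ => if y = iₘ then ℓ x else if x = y then (1 : k) else 0).BlockTriangular
        id ∧
      (Matrix.of fun x y : σ => if y = iₘ then ℓ x else if x = y then (1 : k) else 0).det = ℓ iₘ := by
  have hut : (Matrix.of fun x y : σ => if y = iₘ then ℓ x else if x = y then (1 : k) else 0).BlockTriangular
      id := by
    intro x y hyx
    change y < x at hyx
    rw [Matrix.of_apply, if_neg (fun h => (h ▸ hyx).not_ge (hiₘ x)), if_neg (Ne.symm hyx.ne)]
  refine ⟨hut, ?_⟩
  rw [Matrix.det_of_upperTriangular hut, Finset.prod_eq_single iₘ]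
  · simp
  · intro x _ hx
    simp [hx]
  · exact fun h => absurd (Finset.mem_univ _) h

/-- **BIP Thm. 4.9(2) (Kadish–Landsberg) in weight form, over any infinite field.** Let
`f = X_a^r · p` be a padded form (`X_a` a coordinate; BIP allow any linear form `X ∈ V^*`, which
for `X ≠ 0` is a coordinate after a change of basis leaving the orbit closure unchanged — that
reduction is not needed here) and `χ` a highest weight of `k[Δ_m[f]]`. Then for some `D` with
`|χ| = -m D` (the degree), `-χ(iₘ) ≥ r D` at the greatest index `iₘ`; in partition terms
`λ₁ ≥ r D` for `χ = λ^*` (`exists_eq_dualOfPartition_of_hasHighestWeight_orbitCoordRep_of_size_eq`,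
`Weight.dualOfPartition_apply_last`). BIP: "(2) Suppose `p = ℓ^{n-m} p'` ... If `λ ⊢ nd` occurs in
`ℂ[Z]_d`, then `λ₁ ≥ d(n-m)`." Proof on the orbit: for generic `g` (`F(g·f) ≠ 0`,
`(g·X_a)_{iₘ} ≠ 0`) the Borel element `b` with `b·X_{iₘ} = g·X_a` gives the orbit point
`b⁻¹g·f = X_{iₘ}^r · p₁` with `F ≠ 0` there, all of whose monomials are divisible by `X_{iₘ}^r`
(`exists_monWeight_eq_of_sub_mem`). [cite: BurgisserIkenmeyerPanovaJAMS2019, Thm. 4.9(2)] -/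
theorem exists_size_eq_and_mul_le_of_hasHighestWeight_orbitCoordRep_X_pow_mul [Infinite k]
    (iₘ : σ) (hiₘ : ∀ i, i ≤ iₘ) (a : σ) (r : ℕ) (p : MvPolynomial σ k) {χ : Literature.NumberTheory.DiophantineGeometry.Weight σ}
    (h : Literature.NumberTheory.DiophantineGeometry.HasHighestWeight (orbitCoordRep (X a ^ r * p) m) χ) :
    ∃ D : ℕ, χ.size = -((m * D : ℕ) : ℤ) ∧ ((r * D : ℕ) : ℤ) ≤ -χ iₘ := by
  classical
  set f : MvPolynomial σ k := X a ^ r * p with hf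
  obtain ⟨F, hFI, hF⟩ := exists_lift_of_hasHighestWeight_orbitCoordRep f h
  -- a generic `g`: `F(g · f) ≠ 0` and `g_{iₘ a} ≠ 0`
  obtain ⟨g, hgF, hga⟩ := exists_gl_aeval_ne_zero_and_eval_ne_zero hFI
    (MvPolynomial.X_ne_zero ((iₘ, a) : σ × σ))
  rw [eval_X] at hga
  change (g : Matrix σ σ k) iₘ a ≠ 0 at hga
  -- the Borel element `b` with `b · X_{iₘ} = g · X_a`
  set ℓ : σ → k := fun x => (g : Matrix σ σ k) x a with hℓ
  set bM : Matrix σ σ k := Matrix.of fun x y : σ => if y = iₘ then ℓ x else if x = y then 1 else 0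
    with hbM
  obtain ⟨hbut, hbdet⟩ := isUpperTriangular_and_det_of_col_last (k := k) iₘ hiₘ ℓ
  have hbdet' : bM.det ≠ 0 := by rw [hbdet]; exact hga
  set b : GL σ k := Matrix.GeneralLinearGroup.mkOfDetNeZero bM hbdet' with hb
  have hbu : Literature.NumberTheory.DiophantineGeometry.IsUpperTriangular b := hbut
  have hbX : linSubstRep σ k b (X iₘ) = linSubstRep σ k g (X a) := by
    rw [linSubstRep_apply, linSubstRep_apply, linSubst_X, linSubst_X]
    refine Finset.sum_congr rfl fun x _ => ?_
    rw [hb, Matrix.GeneralLinearGroup.val_mkOfDetNeZero, hbM, Matrix.of_apply, if_pos rfl]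
  have hbinvX : linSubstRep σ k b⁻¹ (linSubstRep σ k g (X a)) = X iₘ := by
    rw [← hbX, ← Module.End.mul_apply, ← map_mul, inv_mul_cancel, map_one, Module.End.one_apply]
  -- the orbit point `q₁ = b⁻¹ g · f = X_{iₘ}^r · p₁`
  set p₁ : MvPolynomial σ k := linSubstRep σ k b⁻¹ (linSubstRep σ k g p) with hp₁
  have hq₁ : linSubstRep σ k (b⁻¹ * g) f = X iₘ ^ r * p₁ := by
    have h1 : linSubst σ k ((b⁻¹ : GL σ k) : Matrix σ σ k) (linSubst σ k (g : Matrix σ σ k) (X a)) =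
        X iₘ := by
      simpa only [linSubstRep_apply] using hbinvX
    rw [map_mul (linSubstRep σ k), Module.End.mul_apply, hf]
    simp only [linSubstRep_apply, map_mul (linSubst σ k _), map_pow, h1]
    rw [hp₁, linSubstRep_apply, linSubstRep_apply]
  -- `F(q₁) = χ(b) F(g · f) ≠ 0`
  have hFq₁ : aeval (formCoeff m (linSubstRep σ k (b⁻¹ * g) f)) F ≠ 0 := by
    rw [map_mul (linSubstRep σ k), Module.End.mul_apply,
      aeval_formCoeff_inv_eq_of_sub_mem (hF b hbu) g]
    exact mul_ne_zero (Literature.NumberTheory.DiophantineGeometry.weightChar_ne_zero χ hbu) hgF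
  -- the monomial of weight `χ` supported at `q₁`
  obtain ⟨s, _, hw, hsupp⟩ := exists_monWeight_eq_of_sub_mem hF (b⁻¹ * g) hFq₁
  refine ⟨s.degree, by rw [← hw, size_monWeight], ?_⟩
  rw [← hw]
  refine mul_degree_le_neg_monWeight_apply s fun d hd => ?_
  have hc := hsupp d hd
  rw [hq₁, X_pow_eq_monomial, coeff_monomial_mul'] at hc
  by_contra hlt
  exact hc (if_neg fun hle => hlt (Finsupp.single_le_iff.mp hle))

end FirstRow


/-! ### BIP Thm. 4.9(1): lengths of weights occurring for forms in few variables -/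

section Length

variable {m : ℕ}

omit [LinearOrder σ] in
/-- If the columns `a ∈ A` of `M` are supported on `T`, then substituting `M` into a polynomial
in the variables `A` gives a polynomial in the variables `T`. [folklore] -/
theorem vars_linSubst_subset [DecidableEq σ] {A : Finset σ} {T : Set σ} (M : Matrix σ σ k)
    (hM : ∀ x a, a ∈ A → x ∉ T → M x a = 0) {f : MvPolynomial σ k}
    (hf : ↑f.vars ⊆ (A : Set σ)) : ↑(linSubst σ k M f).vars ⊆ T := by
  have hf' : f ∈ MvPolynomial.supported k (↑A : Set σ) := MvPolynomial.mem_supported.mpr hf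
  rw [MvPolynomial.supported_eq_range_rename] at hf'
  obtain ⟨f', rfl⟩ := hf'
  have hg : ∀ a : (↑A : Set σ), (∑ x, M x a • X x : MvPolynomial σ k) ∈ MvPolynomial.supported k T :=
    fun a => Subalgebra.sum_mem _ fun x _ => by
      by_cases hx : x ∈ T
      · exact Subalgebra.smul_mem _ (MvPolynomial.X_mem_supported.mpr hx) _
      · rw [hM x a a.2 hx, zero_smul]
        exact Subalgebra.zero_mem _
  have h1 : linSubst σ k M (rename ((↑) : (↑A : Set σ) → σ) f') =
      aeval (fun a : (↑A : Set σ) => ∑ x, M x a • X x) f' := by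
    change aeval _ (rename _ f') = _
    rw [aeval_rename]
    rfl
  have hmem : aeval (fun a : (↑A : Set σ) => ∑ x, M x a • X x) f' ∈ MvPolynomial.supported k T := by
    have hr : (aeval (R := k) fun a : (↑A : Set σ) => (∑ x, M x a • X x : MvPolynomial σ k)).range ≤
        MvPolynomial.supported k T := by
      rw [MvPolynomial.aeval_range, Algebra.adjoin_le_iff]
      rintro _ ⟨a, rfl⟩
      exact hg a
    exact hr ⟨f', rfl⟩
  change ↑(linSubst σ k M (rename ((↑) : (↑A : Set σ) → σ) f')).vars ⊆ T
  rw [h1]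
  exact MvPolynomial.mem_supported.mp hmem

omit [LinearOrder σ] in
/-- A double sum against an indicator: `∑_y (∑_u [y = t u] c_u) φ_y = ∑_u c_u φ_{t u}`.
[folklore] -/
theorem sum_sum_ite_mul {ι : Type*} [Fintype ι] [DecidableEq σ] (t : ι → σ) (c : ι → k)
    (φ : σ → k) : ∑ y, (∑ u, if y = t u then c u else 0) * φ y = ∑ u, c u * φ (t u) := by
  simp_rw [Finset.sum_mul, ite_mul, zero_mul]
  rw [Finset.sum_comm]
  refine Finset.sum_congr rfl fun u _ => ?_
  rw [Finset.sum_ite_eq' Finset.univ (t u) (fun y => c u * φ y), if_pos (Finset.mem_univ _)]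

/-- **BIP Thm. 4.9(1) in weight form, over any infinite field.** Let `f` be a form in the
variables `A ⊆ σ` only (`vars f ⊆ A`, i.e. `f = π^*(p)` is pulled back along the coordinate
projection `π : V → W = k^A`; BIP allow any projection, which is a coordinate projection after a
change of basis leaving the orbit closure unchanged — not needed here) and let `χ` be a highest weight of `k[Δ_m[f]]`. Then `χ` vanishes at the
bottom `N - |A|` indices of `σ` (enumerated increasingly by `e : Fin N ≃o σ`); in partition terms
`ℓ(λ) ≤ |A| = dim W` for `χ = λ^*` (`card_parts_le_of_dualOfPartition_apply_eq_zero`). BIP: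
"(1) Assume `π : V → W` is a projection, `p ∈ Sym^n W^*` ... If `λ ⊢ nd` occurs in `ℂ[Z]_d`, then
`ℓ(λ) ≤ dim W`." Proof on the orbit (big Schubert cell instead of BIP's lifting): for generic `g`
(`F(g·f) ≠ 0` and the minor of `g` on rows `T` = top `|A|` indices, columns `A`, invertible) a
unipotent upper triangular `b = 1 + C` (`C² = 0`) satisfies `(b⁻¹ g)_{x a} = 0` for `x ∉ T`,
`a ∈ A`, so the orbit point `b⁻¹ g · f` lies in `k[X_T]` and `F ≠ 0` there; the monomial of weight
`χ` supported at that point involves only variables in `T` (`exists_monWeight_eq_of_sub_mem`).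
[cite: BurgisserIkenmeyerPanovaJAMS2019, Thm. 4.9(1)] -/
theorem apply_eq_zero_of_hasHighestWeight_orbitCoordRep_of_vars_subset [Infinite k] {N : ℕ}
    (e : Fin N ≃o σ) (f : MvPolynomial σ k) (A : Finset σ) (hfA : ↑f.vars ⊆ (A : Set σ))
    {χ : Literature.NumberTheory.DiophantineGeometry.Weight σ} (h : Literature.NumberTheory.DiophantineGeometry.HasHighestWeight (orbitCoordRep f m) χ) (i : Fin N)
    (hi : (i : ℕ) + A.card < N) : χ (e i) = 0 := by
  classical
  have hLN : A.card ≤ N := by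
    have := A.card_le_univ
    rwa [← Fintype.card_congr e.toEquiv, Fintype.card_fin] at this
  -- enumerations of `A` and of the top `|A|` indices `T`
  set eA : Fin A.card ≃ A := A.equivFin.symm with heA
  set eT : Fin A.card → σ := fun u => e ⟨N - A.card + u, by omega⟩ with heT
  have heT_symm : ∀ u, ((e.symm (eT u) : Fin N) : ℕ) = N - A.card + u := fun u => by
    rw [heT, OrderIso.symm_apply_apply]
  have heT_inj : Function.Injective eT := by
    intro u v huv
    have h1 := congrArg (fun x => ((e.symm x : Fin N) : ℕ)) huv
    simp only [heT_symm] at h1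
    exact Fin.ext (by omega)
  -- the lift `F` and a generic `g`
  obtain ⟨F, hFI, hF⟩ := exists_lift_of_hasHighestWeight_orbitCoordRep f h
  set Q : MvPolynomial (σ × σ) k :=
    (Matrix.of fun u v : Fin A.card =>
      (MvPolynomial.X (eT u, ((eA v : A) : σ)) : MvPolynomial (σ × σ) k)).det with hQ
  have hQeval : ∀ M : Matrix σ σ k, eval (fun ij : σ × σ => M ij.1 ij.2) Q =
      (Matrix.of fun u v : Fin A.card => M (eT u) ((eA v : A) : σ)).det := by
    intro M
    rw [hQ, RingHom.map_det, RingHom.mapMatrix_apply]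
    congr 1
    ext u v
    simp
  have hQ0 : Q ≠ 0 := by
    intro hQ0
    set P : Matrix σ σ k :=
      Matrix.of fun x y => if ∃ u, x = eT u ∧ y = ((eA u : A) : σ) then 1 else 0 with hP
    have hPQ := hQeval P
    rw [hQ0, map_zero] at hPQ
    have hsub : (Matrix.of fun u v : Fin A.card => P (eT u) ((eA v : A) : σ)) = 1 := by
      ext u v
      rw [Matrix.of_apply, hP, Matrix.of_apply, Matrix.one_apply]
      by_cases huv : u = v
      · subst huv
        rw [if_pos ⟨u, rfl, rfl⟩, if_pos rfl]
      · rw [if_neg huv, if_neg]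
        rintro ⟨w, hw1, hw2⟩
        exact huv ((heT_inj hw1).trans (eA.injective (Subtype.ext hw2)).symm)
    rw [hsub, Matrix.det_one] at hPQ
    exact one_ne_zero hPQ.symm
  obtain ⟨g, hgF, hgQ⟩ := exists_gl_aeval_ne_zero_and_eval_ne_zero hFI hQ0
  rw [hQeval] at hgQ
  set Ng : Matrix (Fin A.card) (Fin A.card) k :=
    Matrix.of fun u v : Fin A.card => (g : Matrix σ σ k) (eT u) ((eA v : A) : σ) with hNg
  have hinv : Ng⁻¹ * Ng = 1 := Matrix.nonsing_inv_mul Ng (Ne.isUnit hgQ)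
  -- the unipotent correction `C` (rows outside `T`, columns in `T`) and `b = 1 + C`
  set C : Matrix σ σ k := Matrix.of fun x y =>
    if ((e.symm x : Fin N) : ℕ) < N - A.card then
      ∑ u : Fin A.card, (if y = eT u then
        ∑ v : Fin A.card, (g : Matrix σ σ k) x ((eA v : A) : σ) * Ng⁻¹ v u else 0)
    else 0 with hC
  have hC_row : ∀ x y, N - A.card ≤ ((e.symm x : Fin N) : ℕ) → C x y = 0 := fun x y hx => by
    rw [hC, Matrix.of_apply, if_neg (not_lt.mpr hx)]
  have hC_col : ∀ x y, ((e.symm y : Fin N) : ℕ) < N - A.card → C x y = 0 := fun x y hy => by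
    rw [hC, Matrix.of_apply]
    split_ifs with hx
    · refine Finset.sum_eq_zero fun u _ => if_neg ?_
      rintro rfl
      rw [heT_symm] at hy
      omega
    · rfl
  have hC2 : C * C = 0 := by
    ext x z
    rw [Matrix.mul_apply, Matrix.zero_apply]
    refine Finset.sum_eq_zero fun y _ => ?_
    by_cases hy : ((e.symm y : Fin N) : ℕ) < N - A.card
    · rw [hC_col x y hy, zero_mul]
    · rw [hC_row y z (not_lt.mp hy), mul_zero]
  have hCdiag : ∀ x, C x x = 0 := fun x => by
    by_cases hx : ((e.symm x : Fin N) : ℕ) < N - A.card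
    · exact hC_col x x hx
    · exact hC_row x x (not_lt.mp hx)
  set b : GL σ k := ⟨1 + C, 1 - C,
    by rw [add_mul, mul_sub, mul_sub, one_mul, one_mul, mul_one, hC2]; abel,
    by rw [sub_mul, mul_add, mul_add, one_mul, one_mul, mul_one, hC2]; abel⟩ with hb
  have hbu : Literature.NumberTheory.DiophantineGeometry.IsUpperTriangular b := by
    intro x y hyx
    change (1 + C) x y = 0
    change y < x at hyx
    rw [Matrix.add_apply, Matrix.one_apply_ne (Ne.symm hyx.ne), zero_add]
    by_cases hx : ((e.symm x : Fin N) : ℕ) < N - A.card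
    · by_cases hy : ((e.symm y : Fin N) : ℕ) < N - A.card
      · exact hC_col x y hy
      · exfalso
        have hxy : e.symm x < e.symm y := Fin.lt_def.mpr (by omega)
        exact (e.symm.lt_iff_lt.mp hxy).not_gt hyx
    · exact hC_row x y (not_lt.mp hx)
  have hchar : Literature.NumberTheory.DiophantineGeometry.weightChar χ b = 1 := by
    rw [Literature.NumberTheory.DiophantineGeometry.weightChar]
    refine Finset.prod_eq_one fun x _ => ?_
    change ((1 + C) x x) ^ χ x = 1
    rw [Matrix.add_apply, Matrix.one_apply_eq, hCdiag, add_zero, one_zpow]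
  -- `(b⁻¹ g)_{x a} = 0` for `x ∉ T`, `a ∈ A`
  have hkey : ∀ x a, a ∈ A → ((e.symm x : Fin N) : ℕ) < N - A.card →
      ((1 - C) * (g : Matrix σ σ k)) x a = 0 := by
    intro x a ha hx
    obtain ⟨w, hw⟩ : ∃ w : Fin A.card, ((eA w : A) : σ) = a := ⟨eA.symm ⟨a, ha⟩, by simp⟩
    subst hw
    rw [Matrix.sub_mul, Matrix.one_mul, Matrix.sub_apply, Matrix.mul_apply, sub_eq_zero]
    simp only [hC, Matrix.of_apply, if_pos hx]
    rw [sum_sum_ite_mul]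
    have hNg' : ∀ u, (g : Matrix σ σ k) (eT u) ((eA w : A) : σ) = Ng u w := fun u => rfl
    simp_rw [hNg', Finset.sum_mul]
    rw [Finset.sum_comm]
    simp_rw [mul_assoc, ← Finset.mul_sum, ← Matrix.mul_apply, hinv, Matrix.one_apply, mul_ite,
      mul_one, mul_zero, Finset.sum_ite_eq', Finset.mem_univ, if_true]
  -- the orbit point `q₁ = b⁻¹ g · f` lies in `k[X_T]`
  have hq₁ : linSubstRep σ k (b⁻¹ * g) f = linSubst σ k ((1 - C) * (g : Matrix σ σ k)) f := by
    rw [linSubstRep_apply, Units.val_mul]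
    rfl
  have hvars : ↑(linSubstRep σ k (b⁻¹ * g) f).vars ⊆ {x : σ | N - A.card ≤ ((e.symm x : Fin N) : ℕ)} := by
    rw [hq₁]
    exact vars_linSubst_subset _ (fun x a ha hx => hkey x a ha (not_le.mp hx)) hfA
  -- `F(q₁) = χ(b) F(g · f) = F(g · f) ≠ 0`
  have hFq₁ : aeval (formCoeff m (linSubstRep σ k (b⁻¹ * g) f)) F ≠ 0 := by
    rw [map_mul (linSubstRep σ k), Module.End.mul_apply,
      aeval_formCoeff_inv_eq_of_sub_mem (hF b hbu) g, hchar, one_mul]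
    exact hgF
  -- the monomial of weight `χ` supported at `q₁` only involves variables of `T`
  obtain ⟨s, _, hw, hsupp⟩ := exists_monWeight_eq_of_sub_mem hF (b⁻¹ * g) hFq₁
  rw [← hw]
  refine monWeight_apply_eq_zero s fun d hd => ?_
  by_contra hne
  have hmem : e i ∈ (linSubstRep σ k (b⁻¹ * g) f).vars :=
    (mem_vars_iff_mem_support _).mpr
      ⟨d.1, mem_support_iff.mpr (hsupp d hd), Finsupp.mem_support_iff.mpr hne⟩
  have := hvars hmem
  simp only [Set.mem_setOf_eq, OrderIso.symm_apply_apply] at this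
  omega

end Length

end Literature.Computability.AlgebraicComplexity
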